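import Literature.NumberTheory.Sieve.RosserSieveLemma18
import HarnessLib

/-!
# Iwaniec's Lemma 14: positivity and decay of the majorants `Q^±` (the part of Lemma 13 used)

Topic `Literature/NumberTheory/Sieve`; seventh file on Iwaniec, *Rosser's sieve*, Acta Arith. 36
(1980) (after `RosserSieveMainTerm`, `RosserSieveSums`, `RosserSievePartialSummation`,
`RosserSieveRecurrences`, `RosserSieveMajorants`, `RosserSieveLemma17`, `RosserSieveLemma18`).

`RosserSieveLemma18.lean` proves Lemma 18 (and with it the identification
`F = 1 + s^{−κ} T⁺`, `f = 1 − s^{−κ} T⁻` of Iwaniec's sieve functions) for `κ > 1/2` from the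
*majorant hypotheses* `BetaSieve.MajorantHyp κ β`: `β > 1`, positivity of `q^± = s^{κ+1} Q^±` on
`(0, ∞)`, and super-exponential decay of `q^±` — the part of Lemma 13 (§6) that Lemmas 17–18 use.
This file PROVES these hypotheses for the greatest `β`-sieve data of every dimension `κ > 1/2`
(`BetaSieve.majorantHyp_of_greatest`), following §6 of the paper but stopping short of the
asymptotics (6.4)–(6.5) (Lemmas 15–16, the de Bruijn-type analysis), which are not needed:

* `β > 1` (p. 173): `q_κ` has a positive zero (`SieveAdjoint.exists_zero_qFun`) and every zero
  `ρ` makes `1 + ρ` admissible (`BetaSieveForward.exists_isBetaSieveSolution_of_qFun_eq_zero`),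
  so the greatest `β` exceeds `1`; by the same maximality `g = q_κ` has no zero beyond `β − 1`,
  hence (being eventually positive, `q_κ(s) ∼ s^{2κ−1}`) `g > 0` on `(β − 1, ∞)` — Iwaniec's
  "`β − 1` is the largest zero of `G' = 2κ g`" (p. 190).
* Iwaniec's adjoint `G` ((6.10)–(6.11)): `adjG κ β s = 2κ ∫_{β−1}^s g − κ ∫_{β−1}^β g`, with
  `G' = 2κ g`, `G(s) + G(s + 1) = 2 s g(s)`, `(s G)' = (κ + 1) G + κ G(s + 1)`,
  `(x^{−κ} G)' = κ x^{−κ−1} G(x + 1)`, `G` increasing on `[β − 1, ∞)`, `G(β − 1) = −G(β) < 0`;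
  (6.17)–(6.18).
* `a = s^{−κ−1}(q⁺ + q⁻)`, `b = s^{−κ−1}(q⁺ − q⁻)` (`majA`, `majB`), their equations (6.8)–(6.9)
  on `(β + 1, ∞)` and the inhomogeneous versions on `(β, β + 1)`; the pairings (6.12)–(6.13)
  `⟨a, G⟩(s) = s G(s) a(s) − κ ∫_{s−1}^s G(x + 1) a(x) dx`, `⟨b, 1⟩(s) = s b(s) + κ ∫_{s−1}^s b`
  (as `sieveInnerProduct`s) and the vanishing of their constants `c₁ = c₂ = 0`
  (`pairA_eq_zero`, `pairB_eq_zero`).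
* Lemma 14 with `η = 1`, i.e. positivity (`qUpper_pos_qLower_pos`): (6.15)–(6.16) on `(0, β + 1]`
  through the increasing function `t^{−κ}(G(t) + G(β))` (Iwaniec's `C(t)`), then the
  continuation argument of p. 191 at the infimum of the bad set.
* Decay without (6.4)–(6.5): `a` is decreasing ((6.8)), so (6.12) gives
  `s G(s) a(s) ≤ κ G(s + 1) a(s − 1)`, and `G(s + 1) ≤ 2 s g(s) ≤ 4 s^{2κ}`, `G(s) ≥ s^{2κ}/4`
  eventually; hence `a(s) ≤ (16κ/s) a(s − 1)`, which iterates to `q⁺ + q⁻ ≤ e^{−Ms}` eventually,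
  for every `M` (`eventually_qUpper_add_qLower_le`).

Consequences (namespace `Literature.BetaSieve`): `majorantHyp_of_greatest`, `lemma17`, `lemma18`,
`eqOn_cand_of_greatest` (Lemmas 17–18 and `F = 1 + s^{−κ}T⁺`, `f = 1 − s^{−κ}T⁻` for `κ > 1/2`,
unconditionally), `Iwaniec1980_lemma18_of_half` (the named fact `Iwaniec1980_lemma18` of
`RosserSieveSums.lean` now rests only on its boundary case `κ = 1/2`,
`Iwaniec1980_lemma18_half`), and `SieveSequence.Iwaniec1980_lower_of_lemma20` /
`…upper_of_lemma20`: the corrected Theorem 1 for sieve sequences from the two remaining named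
facts `Iwaniec1980_lemma18_half` and `Iwaniec1980_lemma20`.

## References

* H. Iwaniec, *Rosser's sieve*, Acta Arith. 36 (1980), 171–202: §6, (6.1)–(6.18), Lemmas 13–14,
  pp. 189–192; §7, p. 193. [IwaniecActaArith1980]
* G. Greaves, *Sieves in Number Theory*, Springer (2001), §4.2.3 ((4.2.3.13), Lemma 4.2.3).
  [Greaves2001]
-/

open Filter Set MeasureTheory intervalIntegral Asymptotics
open scoped Topology

noncomputable section

namespace Literature.NumberTheory.Sieve

open SieveAdjoint RosserMajorant BetaSieve

/-! ### `β > 1` and the sign of `g = q_κ` beyond `β − 1`, for the greatest data -/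

namespace IsGreatestBetaSieveData

variable {κ : ℝ} {B : (ℝ → ℝ) × (ℝ → ℝ) × ℝ × ℝ}

/-- **`β_κ > 1` for `κ > 1/2`** (Iwaniec, p. 173: "`κ > 1/2`: `β > 1`"): `q_κ` has a positive zero
`ρ` (`exists_zero_qFun`), `1 + ρ` is admissible (`exists_isBetaSieveSolution_of_qFun_eq_zero`),
and the greatest data have the greatest admissible `β`. [cite: IwaniecActaArith1980, §1 (p. 173)] -/
theorem one_lt_beta (hκ : 1 / 2 < κ) (hB : IsGreatestBetaSieveData κ B) : 1 < B.2.2.1 := by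
  obtain ⟨ρ, hρ, h0⟩ := exists_zero_qFun hκ
  obtain ⟨F', f', A', h'⟩ := BetaSieveForward.exists_isBetaSieveSolution_of_qFun_eq_zero hκ hρ h0
  have := hB.2 F' f' _ A' h'
  linarith

/-- **`q_κ` has no zero beyond `β_κ − 1`** (maximality: a zero `ρ > β − 1` would make `1 + ρ > β`
admissible); i.e. `β_κ − 1` is the largest zero of `g` (Iwaniec, §7, p. 193).
[cite: IwaniecActaArith1980, §7 (p. 193)] -/
theorem qFun_ne_zero_of_gt (hκ : 1 / 2 < κ) (hB : IsGreatestBetaSieveData κ B) {s : ℝ}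
    (hs : B.2.2.1 - 1 < s) : qFun κ s ≠ 0 := by
  intro h0
  have hs0 : 0 < s := by linarith [hB.1.one_le]
  obtain ⟨F', f', A', h'⟩ := BetaSieveForward.exists_isBetaSieveSolution_of_qFun_eq_zero hκ hs0 h0
  have := hB.2 F' f' _ A' h'
  linarith

/-- **`g = q_κ > 0` on `(β_κ − 1, ∞)`**: `g` is eventually positive (`q_κ(s) ∼ s^{2κ−1}`) and has no
zero there (intermediate value theorem). This is the fact "since `β − 1` is the largest zero of
`G'(s)`, `G(s)` is increasing for `s > β − 1`" of Iwaniec, p. 190.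
[cite: IwaniecActaArith1980, §6 (p. 190)] -/
theorem qFun_pos_of_gt (hκ : 1 / 2 < κ) (hB : IsGreatestBetaSieveData κ B) {s : ℝ}
    (hs : B.2.2.1 - 1 < s) : 0 < qFun κ s := by
  refine (le_or_gt (qFun κ s) 0).elim (fun hle => False.elim ?_) id
  have hs0 : 0 < s := by linarith [hB.1.one_le]
  obtain ⟨s₂, hs₂pos, hs₂ge⟩ := ((eventually_qFun_pos (by linarith : (0:ℝ) ≤ κ)).and
    (eventually_ge_atTop s)).exists
  have hcont : ContinuousOn (qFun κ) (Icc s s₂) :=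
    (continuousOn_qFun κ).mono fun x hx => lt_of_lt_of_le hs0 hx.1
  obtain ⟨c, hc, hc0⟩ := intermediate_value_Icc hs₂ge hcont ⟨hle, hs₂pos.le⟩
  exact qFun_ne_zero_of_gt hκ hB (lt_of_lt_of_le hs hc.1) hc0

/-- `g(β_κ − 1) = 0` for the greatest data of dimension `κ > 1/2`. [cite: IwaniecActaArith1980, §7 (p. 196)] -/
theorem qFun_beta_sub_one (hκ : 1 / 2 < κ) (hB : IsGreatestBetaSieveData κ B) :
    qFun κ (B.2.2.1 - 1) = 0 :=
  hB.1.qFun_beta_sub_one_eq_zero (by linarith) (one_lt_beta hκ hB)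

end IsGreatestBetaSieveData

namespace RosserMajorant

variable {κ β : ℝ}

/-! ### Iwaniec's adjoint `G` ((6.10)–(6.11)) -/

/-- **Iwaniec's `G`** (p. 190): the solution of the equation `(s G(s))' = (κ + 1) G(s) + κ G(s + 1)`
conjugate to (6.8), with `G' = 2κ g` ((6.11)) and `G(β − 1) + G(β) = 0`:
`G(s) = 2κ ∫_{β−1}^s g − κ ∫_{β−1}^β g`, `g = q_κ = SieveAdjoint.qFun κ`.
[cite: IwaniecActaArith1980, §6 (6.10)–(6.11)] -/
def adjG (κ β : ℝ) (s : ℝ) : ℝ :=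
  2 * κ * (∫ x in (β - 1)..s, qFun κ x) - κ * ∫ x in (β - 1)..β, qFun κ x

/-- `G(β − 1) = −κ ∫_{β−1}^β g`. [folklore] -/
theorem adjG_beta_sub_one : adjG κ β (β - 1) = -(κ * ∫ x in (β - 1)..β, qFun κ x) := by
  simp [adjG]

/-- `G(β) = κ ∫_{β−1}^β g`. [folklore] -/
theorem adjG_beta : adjG κ β β = κ * ∫ x in (β - 1)..β, qFun κ x := by
  rw [adjG]; ring

/-- `G(β − 1) = −G(β)` (Iwaniec, p. 190: "by (6.10), `G(β) = −G(β − 1)`").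
[cite: IwaniecActaArith1980, §6 (p. 190)] -/
theorem adjG_beta_sub_one_eq_neg : adjG κ β (β - 1) = -adjG κ β β := by
  rw [adjG_beta, adjG_beta_sub_one]

/-- `q_κ` is interval integrable between positive reals. [folklore] -/
theorem intervalIntegrable_qFun {u v : ℝ} (hu : 0 < u) (hv : 0 < v) :
    IntervalIntegrable (qFun κ) volume u v :=
  ((continuousOn_qFun κ).mono fun x hx => by
    rcases le_total u v with huv | huv
    · rw [uIcc_of_le huv] at hx; exact lt_of_lt_of_le hu hx.1
    · rw [uIcc_of_ge huv] at hx; exact lt_of_lt_of_le hv hx.1).intervalIntegrable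

/-- `G(v) − G(u) = 2κ ∫_u^v g` for `u, v > 0` (`β > 1`). [folklore] -/
theorem adjG_sub_adjG (hβ : 1 < β) {u v : ℝ} (hu : 0 < u) (hv : 0 < v) :
    adjG κ β v - adjG κ β u = 2 * κ * ∫ x in u..v, qFun κ x := by
  simp only [adjG]
  rw [← integral_add_adjacent_intervals (intervalIntegrable_qFun (by linarith) hu)
    (intervalIntegrable_qFun hu hv)]
  ring

/-- **`G' = 2κ g`** on `(0, ∞)` ((6.11)). [cite: IwaniecActaArith1980, §6 (6.11)] -/
theorem hasDerivAt_adjG (hβ : 1 < β) {s : ℝ} (hs : 0 < s) :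
    HasDerivAt (adjG κ β) (2 * κ * qFun κ s) s := by
  have h1 : HasDerivAt (fun u => ∫ x in (β - 1)..u, qFun κ x) (qFun κ s) s :=
    integral_hasDerivAt_right (intervalIntegrable_qFun (by linarith) hs)
      ((continuousOn_qFun κ).stronglyMeasurableAtFilter isOpen_Ioi s hs)
      ((continuousOn_qFun κ).continuousAt (Ioi_mem_nhds hs))
  have h := (h1.const_mul (2 * κ)).sub_const (κ * ∫ x in (β - 1)..β, qFun κ x)
  exact h

/-- `G` is continuous on `(0, ∞)`. [folklore] -/
theorem continuousOn_adjG (hβ : 1 < β) : ContinuousOn (adjG κ β) (Ioi 0) :=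
  fun _ hs => (hasDerivAt_adjG hβ hs).continuousAt.continuousWithinAt

/-- **`G(s) + G(s + 1) = 2 s g(s)`** for `s > 0`, when `g(β − 1) = 0`: both sides have the same
derivative (`(s g)' = κ g(s) + κ g(s + 1)`) and agree at `β − 1` by the normalisation of `G`.
This is (6.10) for `G` in integrated form. [cite: IwaniecActaArith1980, §6 (6.10)–(6.11)] -/
theorem adjG_add_adjG_add_one (hβ : 1 < β) (h0 : qFun κ (β - 1) = 0) {s : ℝ} (hs : 0 < s) :
    adjG κ β s + adjG κ β (s + 1) = 2 * s * qFun κ s := by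
  set Φ : ℝ → ℝ := fun u => adjG κ β u + adjG κ β (u + 1) - 2 * (u * qFun κ u) with hΦ
  have hder : ∀ u, 0 < u → HasDerivAt Φ 0 u := by
    intro u hu
    have h1 := hasDerivAt_adjG (κ := κ) hβ hu
    have h2 : HasDerivAt (fun v => adjG κ β (v + 1)) (2 * κ * qFun κ (u + 1)) u :=
      (hasDerivAt_adjG (κ := κ) hβ (by linarith : 0 < u + 1)).comp_add_const u 1
    have h3 := hasDerivAt_mul_qFun κ hu
    have h := (h1.add h2).sub (h3.const_mul 2)
    refine h.congr_deriv ?_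
    ring
  have hcont : ∀ u, 0 < u → ContinuousAt Φ u := fun u hu => (hder u hu).continuousAt
  have hval : Φ (β - 1) = 0 := by
    simp only [hΦ]
    rw [adjG_beta_sub_one, show β - 1 + 1 = β by ring, adjG_beta, h0]
    ring
  have hΦs : Φ s = Φ (β - 1) := by
    rcases lt_trichotomy s (β - 1) with h | h | h
    · exact (eq_of_hasDerivAt_zero_Ioo h
        (fun u hu => (hcont u (lt_of_lt_of_le hs hu.1)).continuousWithinAt)
        (fun u hu => hder u (lt_trans hs hu.1))).symm
    · rw [h]
    · exact eq_of_hasDerivAt_zero_Ioo h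
        (fun u hu => (hcont u (by linarith [hu.1])).continuousWithinAt)
        (fun u hu => hder u (by linarith [hu.1]))
  have : Φ s = 0 := hΦs.trans hval
  simp only [hΦ] at this
  linarith

/-- **`(s G(s))' = (κ + 1) G(s) + κ G(s + 1)`** on `(0, ∞)` ((6.10), when `g(β − 1) = 0`).
[cite: IwaniecActaArith1980, §6 (6.10)] -/
theorem hasDerivAt_mul_adjG (hβ : 1 < β) (h0 : qFun κ (β - 1) = 0) {s : ℝ} (hs : 0 < s) :
    HasDerivAt (fun t => t * adjG κ β t) ((κ + 1) * adjG κ β s + κ * adjG κ β (s + 1)) s := by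
  have h := (hasDerivAt_id s).mul (hasDerivAt_adjG (κ := κ) hβ hs)
  have hid := adjG_add_adjG_add_one hβ h0 hs
  refine h.congr_deriv ?_
  simp only [id]
  linear_combination (-κ) * hid

/-- **`(x^{−κ} G(x))' = κ x^{−κ−1} G(x + 1)`** on `(0, ∞)` (Iwaniec, p. 190, "Integrating of
`(s^{−κ} G(s))' = κ s^{−κ−1} G(s + 1)`"). [cite: IwaniecActaArith1980, §6 (6.17)] -/
theorem hasDerivAt_rpow_neg_mul_adjG (hβ : 1 < β) (h0 : qFun κ (β - 1) = 0) {x : ℝ} (hx : 0 < x) :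
    HasDerivAt (fun t : ℝ => t ^ (-κ) * adjG κ β t) (κ * x ^ (-κ - 1) * adjG κ β (x + 1)) x := by
  have h1 : HasDerivAt (fun t : ℝ => t ^ (-κ - 1)) ((-κ - 1) * x ^ (-κ - 1 - 1)) x := by
    simpa using (hasDerivAt_id x).rpow_const (p := -κ - 1) (Or.inl hx.ne')
  have h2 := hasDerivAt_mul_adjG hβ h0 hx
  have h := h1.mul h2
  have e1 : ∀ t : ℝ, 0 < t → t ^ (-κ - 1) * t = t ^ (-κ) := fun t ht => by
    rw [show (-κ - 1 : ℝ) = -κ + (-1) by ring, Real.rpow_add ht, Real.rpow_neg_one]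
    field_simp
  refine (h.congr_of_eventuallyEq ?_).congr_deriv ?_
  · filter_upwards [Ioi_mem_nhds hx] with t (ht : 0 < t)
    show t ^ (-κ) * adjG κ β t = t ^ (-κ - 1) * (t * adjG κ β t)
    rw [← mul_assoc, e1 t ht]
  · have e2 : x ^ (-κ - 1 - 1) * x = x ^ (-κ - 1) := by
      rw [show (-κ - 1 - 1 : ℝ) = (-κ - 1) + (-1) by ring, Real.rpow_add hx, Real.rpow_neg_one]
      field_simp
    calc (-κ - 1) * x ^ (-κ - 1 - 1) * (x * adjG κ β x) +
          x ^ (-κ - 1) * ((κ + 1) * adjG κ β x + κ * adjG κ β (x + 1))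
        = (-κ - 1) * (x ^ (-κ - 1 - 1) * x) * adjG κ β x +
          x ^ (-κ - 1) * ((κ + 1) * adjG κ β x + κ * adjG κ β (x + 1)) := by ring
      _ = κ * x ^ (-κ - 1) * adjG κ β (x + 1) := by rw [e2]; ring

/-! ### Monotonicity and sign of `G` -/

section GSign

variable (hκ : 0 < κ) (hβ : 1 < β) (hg : ∀ x : ℝ, β - 1 < x → 0 < qFun κ x)
include hκ hβ hg

/-- `G` is strictly increasing on `[β − 1, ∞)` when `g > 0` on `(β − 1, ∞)` (Iwaniec, p. 190).
[cite: IwaniecActaArith1980, §6 (p. 190)] -/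
theorem adjG_lt_adjG {u v : ℝ} (hu : β - 1 ≤ u) (huv : u < v) : adjG κ β u < adjG κ β v := by
  have hu0 : 0 < u := by linarith
  have h := adjG_sub_adjG (κ := κ) hβ hu0 (by linarith : 0 < v)
  have hpos : 0 < ∫ x in u..v, qFun κ x :=
    intervalIntegral_pos_of_pos_on (intervalIntegrable_qFun hu0 (by linarith))
      (fun x hx => hg x (by linarith [hx.1])) huv
  nlinarith

/-- Monotone form of `adjG_lt_adjG`. [folklore] -/
theorem adjG_le_adjG {u v : ℝ} (hu : β - 1 ≤ u) (huv : u ≤ v) : adjG κ β u ≤ adjG κ β v := by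
  rcases eq_or_lt_of_le huv with h | h
  · rw [h]
  · exact (adjG_lt_adjG hκ hβ hg hu h).le

/-- `G(β) > 0` (and so `G(β − 1) = −G(β) < 0`). [cite: IwaniecActaArith1980, §6 (p. 190)] -/
theorem adjG_beta_pos : 0 < adjG κ β β := by
  have h := adjG_lt_adjG hκ hβ hg le_rfl (by linarith : β - 1 < β)
  rw [adjG_beta_sub_one_eq_neg] at h
  linarith

/-- `G > 0` on `[β, ∞)`. [cite: IwaniecActaArith1980, §6 (p. 190)] -/
theorem adjG_pos {s : ℝ} (hs : β ≤ s) : 0 < adjG κ β s :=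
  lt_of_lt_of_le (adjG_beta_pos hκ hβ hg) (adjG_le_adjG hκ hβ hg (by linarith) hs)

/-- `G(s + 1) ≤ 2 s g(s)` for `s ≥ β` (from `G(s) + G(s + 1) = 2 s g(s)` and `G(s) > 0`). [folklore] -/
theorem adjG_add_one_le (h0 : qFun κ (β - 1) = 0) {s : ℝ} (hs : β ≤ s) :
    adjG κ β (s + 1) ≤ 2 * s * qFun κ s := by
  have h1 := adjG_add_adjG_add_one hβ h0 (by linarith : 0 < s)
  have h2 := adjG_pos hκ hβ hg hs
  linarith

/-- `G(s) ≤ G(s + 1)` hence `2 G(s) ≤ 2 s g(s)`, i.e. `G(s) ≤ s g(s)`, for `s ≥ β − 1`. [folklore] -/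
theorem adjG_le_mul (h0 : qFun κ (β - 1) = 0) {s : ℝ} (hs : β - 1 ≤ s) :
    adjG κ β s ≤ s * qFun κ s := by
  have h1 := adjG_add_adjG_add_one hβ h0 (by linarith : 0 < s)
  have h2 := adjG_le_adjG hκ hβ hg hs (by linarith : s ≤ s + 1)
  linarith

end GSign

/-! ### The identities (6.17)–(6.18) -/

/-- **(6.17)**: `κ ∫_{β−1}^β x^{−κ−1} G(x + 1) dx = β^{−κ} G(β) − (β − 1)^{−κ} G(β − 1)`.
[cite: IwaniecActaArith1980, §6 (6.17)] -/
theorem integral_rpow_mul_adjG (hβ : 1 < β) (h0 : qFun κ (β - 1) = 0) :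
    ∫ x in (β - 1)..β, κ * x ^ (-κ - 1) * adjG κ β (x + 1) =
      β ^ (-κ) * adjG κ β β - (β - 1) ^ (-κ) * adjG κ β (β - 1) := by
  have hderc : ContinuousOn (fun x : ℝ => κ * x ^ (-κ - 1) * adjG κ β (x + 1)) (Ioi 0) :=
    (continuousOn_const.mul (continuousOn_id.rpow_const fun t ht => Or.inl (ne_of_gt ht))).mul
      (continuousOn_comp_add_one (continuousOn_adjG hβ))
  refine integral_eq_sub_of_hasDerivAt (fun x hx => hasDerivAt_rpow_neg_mul_adjG hβ h0 ?_) ?_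
  · rw [uIcc_of_le (by linarith)] at hx; linarith [hx.1]
  · exact (hderc.mono fun x hx => by
      rw [uIcc_of_le (by linarith)] at hx
      exact show (0:ℝ) < x by linarith [hx.1]).intervalIntegrable

/-- (6.17), shifted: `κ ∫_β^{β+1} (s − 1)^{−κ−1} G(s) ds = β^{−κ} G(β) − (β − 1)^{−κ} G(β − 1)`.
[cite: IwaniecActaArith1980, §6 (6.17)] -/
theorem integral_rpow_mul_adjG' (hβ : 1 < β) (h0 : qFun κ (β - 1) = 0) :
    ∫ s in β..(β + 1), κ * (s - 1) ^ (-κ - 1) * adjG κ β s =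
      β ^ (-κ) * adjG κ β β - (β - 1) ^ (-κ) * adjG κ β (β - 1) := by
  rw [← integral_rpow_mul_adjG hβ h0]
  have hsub := intervalIntegral.integral_comp_sub_right
    (fun x : ℝ => κ * x ^ (-κ - 1) * adjG κ β (x + 1)) (1:ℝ) (a := β) (b := β + 1)
  rw [show β + 1 - 1 = β by ring] at hsub
  rw [← hsub]
  refine intervalIntegral.integral_congr fun s _ => ?_
  simp only [sub_add_cancel]

/-- `∫_{β−1}^β x^{−κ−1} dx = ((β − 1)^{−κ} − β^{−κ})/κ` (`κ ≠ 0`, `β > 1`). [folklore] -/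
theorem integral_rpow_neg (hκ : κ ≠ 0) (hβ : 1 < β) :
    ∫ x in (β - 1)..β, x ^ (-κ - 1) = ((β - 1) ^ (-κ) - β ^ (-κ)) / κ := by
  have h0 : (0:ℝ) ∉ uIcc (β - 1) β := by
    rw [uIcc_of_le (by linarith)]; intro h; linarith [h.1]
  rw [integral_rpow (Or.inr ⟨by intro h; apply hκ; linarith, h0⟩),
    show (-κ - 1 + 1 : ℝ) = -κ by ring]
  field_simp
  ring

/-- **(6.18)**: `∫_β^{β+1} κ (s − 1)^{−κ−1} ds = (β − 1)^{−κ} − β^{−κ}`.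
[cite: IwaniecActaArith1980, §6 (6.18)] -/
theorem integral_rpow_sub_one (hκ : κ ≠ 0) (hβ : 1 < β) :
    ∫ s in β..(β + 1), κ * (s - 1) ^ (-κ - 1) = (β - 1) ^ (-κ) - β ^ (-κ) := by
  have hsub := intervalIntegral.integral_comp_sub_right (fun x : ℝ => κ * x ^ (-κ - 1)) (1:ℝ)
    (a := β) (b := β + 1)
  rw [show β + 1 - 1 = β by ring] at hsub
  rw [hsub, intervalIntegral.integral_const_mul, integral_rpow_neg hκ hβ]
  field_simp

/-! ### The functions `a = Q⁺ + Q⁻` and `b = Q⁺ − Q⁻` ((6.6)–(6.9)) -/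

/-- Iwaniec's `a(s) = s^{−κ−1} (Q⁺(s) + Q⁻(s))·s^{κ+1}… = s^{−κ−1} (q⁺(s) + q⁻(s))` (p. 189).
[cite: IwaniecActaArith1980, §6 (p. 189)] -/
def majA (κ β s : ℝ) : ℝ := s ^ (-κ - 1) * (qUpper κ β s + qLower κ β s)

/-- Iwaniec's `b(s) = s^{−κ−1} (q⁺(s) − q⁻(s))` (p. 189). [cite: IwaniecActaArith1980, §6 (p. 189)] -/
def majB (κ β s : ℝ) : ℝ := s ^ (-κ - 1) * (qUpper κ β s - qLower κ β s)

/-- `a(x) = (β^{−κ} + (β − 1)^{−κ}) x^{−κ−1}` for `x ≤ β` ((6.1)). [cite: IwaniecActaArith1980, §6 (6.1)] -/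
theorem majA_eq_of_le {x : ℝ} (hx : x ≤ β) :
    majA κ β x = (β ^ (-κ) + (β - 1) ^ (-κ)) * x ^ (-κ - 1) := by
  rw [majA, qUpper_eq (by linarith), qLower_eq hx]; ring

/-- `b(x) = (β^{−κ} − (β − 1)^{−κ}) x^{−κ−1}` for `x ≤ β` ((6.1)). [cite: IwaniecActaArith1980, §6 (6.1)] -/
theorem majB_eq_of_le {x : ℝ} (hx : x ≤ β) :
    majB κ β x = (β ^ (-κ) - (β - 1) ^ (-κ)) * x ^ (-κ - 1) := by
  rw [majB, qUpper_eq (by linarith), qLower_eq hx]; ring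

/-- `a` is continuous on `(0, ∞)` (`β > 1`). [folklore] -/
theorem continuousOn_majA (hβ : 1 < β) : ContinuousOn (majA κ β) (Ioi 0) :=
  (continuousOn_id.rpow_const fun _ ht => Or.inl (ne_of_gt ht)).mul
    ((continuousOn_qUpper hβ).add (continuousOn_qLower hβ))

/-- `b` is continuous on `(0, ∞)` (`β > 1`). [folklore] -/
theorem continuousOn_majB (hβ : 1 < β) : ContinuousOn (majB κ β) (Ioi 0) :=
  (continuousOn_id.rpow_const fun _ ht => Or.inl (ne_of_gt ht)).mul
    ((continuousOn_qUpper hβ).sub (continuousOn_qLower hβ))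

/-- `q⁺` is locally constant, hence has derivative `0`, on `(−∞, β + 1)`. [folklore] -/
theorem hasDerivAt_qUpper_zero {s : ℝ} (hs : s < β + 1) : HasDerivAt (qUpper κ β) 0 s := by
  refine (hasDerivAt_const s (β ^ (-κ))).congr_of_eventuallyEq ?_
  filter_upwards [Iio_mem_nhds hs] with t ht
  exact qUpper_eq (le_of_lt ht)

/-- Two power identities used repeatedly: `s^{−κ−1−1} s = s^{−κ−1}` and `s^{−κ−1} s^κ s = 1`.
[folklore] -/
theorem rpow_aux {s : ℝ} (hs : 0 < s) :
    s ^ (-κ - 1 - 1) * s = s ^ (-κ - 1) ∧ s ^ (-κ - 1) * s ^ κ * s = 1 := by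
  constructor
  · rw [show (-κ - 1 - 1 : ℝ) = (-κ - 1) + (-1) by ring, Real.rpow_add hs, Real.rpow_neg_one]
    field_simp
  · rw [← Real.rpow_add hs, show (-κ - 1 + κ : ℝ) = -1 by ring, Real.rpow_neg_one,
      inv_mul_cancel₀ hs.ne']

/-- **The `a`-equation on `(β, β + 1)`** (there `q⁺` is constant and `(q⁻)' = −κ s^κ (s−1)^{−κ−1} β^{−κ}`):
`s a'(s) = −(κ + 1) a(s) − κ a(s − 1) + κ (β − 1)^{−κ} (s − 1)^{−κ−1}`.
[cite: IwaniecActaArith1980, §6 (6.6), (6.8)] -/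
theorem hasDerivAt_majA_of_lt (hβ : 1 < β) {s : ℝ} (hs : β < s) (hs' : s < β + 1) :
    HasDerivAt (majA κ β) ((-(κ + 1) * majA κ β s - κ * majA κ β (s - 1) +
      κ * (β - 1) ^ (-κ) * (s - 1) ^ (-κ - 1)) / s) s := by
  have hs0 : 0 < s := by linarith
  have h1 : HasDerivAt (fun t : ℝ => t ^ (-κ - 1)) ((-κ - 1) * s ^ (-κ - 1 - 1)) s := by
    simpa using (hasDerivAt_id s).rpow_const (p := -κ - 1) (Or.inl hs0.ne')
  have hU : HasDerivAt (qUpper κ β) 0 s := hasDerivAt_qUpper_zero hs'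
  have hL := hasDerivAt_qLower (κ := κ) hβ hs
  have h := h1.mul (hU.add hL)
  refine (h.congr_of_eventuallyEq (Eventually.of_forall fun t => rfl)).congr_deriv ?_
  rw [qUpper_eq (by linarith : s - 1 ≤ β + 1), majA_eq_of_le (by linarith : s - 1 ≤ β), majA,
    eq_div_iff hs0.ne']
  obtain ⟨e1, e2⟩ := rpow_aux (κ := κ) hs0
  simp only [Pi.add_apply]
  linear_combination ((-κ - 1) * (qUpper κ β s + qLower κ β s)) * e1 -
    (κ * (s - 1) ^ (-κ - 1) * β ^ (-κ)) * e2

/-- **The `a`-equation (6.8) on `(β + 1, ∞)`**: `s a'(s) = −(κ + 1) a(s) − κ a(s − 1)`.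
[cite: IwaniecActaArith1980, §6 (6.8)] -/
theorem hasDerivAt_majA_of_gt (hβ : 1 < β) {s : ℝ} (hs : β + 1 < s) :
    HasDerivAt (majA κ β) ((-(κ + 1) * majA κ β s - κ * majA κ β (s - 1)) / s) s := by
  have hs0 : 0 < s := by linarith
  have h1 : HasDerivAt (fun t : ℝ => t ^ (-κ - 1)) ((-κ - 1) * s ^ (-κ - 1 - 1)) s := by
    simpa using (hasDerivAt_id s).rpow_const (p := -κ - 1) (Or.inl hs0.ne')
  have hU := hasDerivAt_qUpper (κ := κ) hβ hs
  have hL := hasDerivAt_qLower (κ := κ) hβ (by linarith : β < s)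
  have h := h1.mul (hU.add hL)
  refine (h.congr_of_eventuallyEq (Eventually.of_forall fun t => rfl)).congr_deriv ?_
  rw [majA, majA, eq_div_iff hs0.ne']
  obtain ⟨e1, e2⟩ := rpow_aux (κ := κ) hs0
  simp only [Pi.add_apply]
  linear_combination ((-κ - 1) * (qUpper κ β s + qLower κ β s)) * e1 -
    (κ * (s - 1) ^ (-κ - 1) * (qLower κ β (s - 1) + qUpper κ β (s - 1))) * e2

/-- **The `b`-equation on `(β, β + 1)`**:
`s b'(s) = −(κ + 1) b(s) + κ b(s − 1) + κ (β − 1)^{−κ} (s − 1)^{−κ−1}`.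
[cite: IwaniecActaArith1980, §6 (6.7), (6.9)] -/
theorem hasDerivAt_majB_of_lt (hβ : 1 < β) {s : ℝ} (hs : β < s) (hs' : s < β + 1) :
    HasDerivAt (majB κ β) ((-(κ + 1) * majB κ β s - (-κ) * majB κ β (s - 1) +
      κ * (β - 1) ^ (-κ) * (s - 1) ^ (-κ - 1)) / s) s := by
  have hs0 : 0 < s := by linarith
  have h1 : HasDerivAt (fun t : ℝ => t ^ (-κ - 1)) ((-κ - 1) * s ^ (-κ - 1 - 1)) s := by
    simpa using (hasDerivAt_id s).rpow_const (p := -κ - 1) (Or.inl hs0.ne')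
  have hU : HasDerivAt (qUpper κ β) 0 s := hasDerivAt_qUpper_zero hs'
  have hL := hasDerivAt_qLower (κ := κ) hβ hs
  have h := h1.mul (hU.sub hL)
  refine (h.congr_of_eventuallyEq (Eventually.of_forall fun t => rfl)).congr_deriv ?_
  rw [qUpper_eq (by linarith : s - 1 ≤ β + 1), majB_eq_of_le (by linarith : s - 1 ≤ β), majB,
    eq_div_iff hs0.ne']
  obtain ⟨e1, e2⟩ := rpow_aux (κ := κ) hs0
  simp only [Pi.sub_apply]
  linear_combination ((-κ - 1) * (qUpper κ β s - qLower κ β s)) * e1 +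
    (κ * (s - 1) ^ (-κ - 1) * β ^ (-κ)) * e2

/-- **The `b`-equation (6.9) on `(β + 1, ∞)`**: `s b'(s) = −(κ + 1) b(s) + κ b(s − 1)`.
[cite: IwaniecActaArith1980, §6 (6.9)] -/
theorem hasDerivAt_majB_of_gt (hβ : 1 < β) {s : ℝ} (hs : β + 1 < s) :
    HasDerivAt (majB κ β) ((-(κ + 1) * majB κ β s - (-κ) * majB κ β (s - 1)) / s) s := by
  have hs0 : 0 < s := by linarith
  have h1 : HasDerivAt (fun t : ℝ => t ^ (-κ - 1)) ((-κ - 1) * s ^ (-κ - 1 - 1)) s := by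
    simpa using (hasDerivAt_id s).rpow_const (p := -κ - 1) (Or.inl hs0.ne')
  have hU := hasDerivAt_qUpper (κ := κ) hβ hs
  have hL := hasDerivAt_qLower (κ := κ) hβ (by linarith : β < s)
  have h := h1.mul (hU.sub hL)
  refine (h.congr_of_eventuallyEq (Eventually.of_forall fun t => rfl)).congr_deriv ?_
  rw [majB, majB, eq_div_iff hs0.ne']
  obtain ⟨e1, e2⟩ := rpow_aux (κ := κ) hs0
  simp only [Pi.sub_apply]
  linear_combination ((-κ - 1) * (qUpper κ β s - qLower κ β s)) * e1 -
    (κ * (s - 1) ^ (-κ - 1) * (qLower κ β (s - 1) - qUpper κ β (s - 1))) * e2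

/-! ### The pairings (6.12)–(6.13) and the vanishing of their constants -/

section Pairings

variable (hκ : 0 < κ) (hβ : 1 < β) (h0 : qFun κ (β - 1) = 0)
include hκ hβ h0

omit hκ h0 in
/-- `x ↦ G(x + 1) a(x)` is continuous on `(0, ∞)`. [folklore] -/
theorem continuousOn_adjG_mul_majA :
    ContinuousOn (fun x => adjG κ β (x + 1) * majA κ β x) (Ioi 0) :=
  (continuousOn_comp_add_one (continuousOn_adjG hβ)).mul (continuousOn_majA hβ)

omit hκ in
/-- **The derivative of `⟨a, G⟩(s) = s G(s) a(s) − κ ∫_{s−1}^s G(x + 1) a(x) dx` on `(β, β + 1)`**: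
`G(s) · κ (β − 1)^{−κ} (s − 1)^{−κ−1}` (the inhomogeneity of the `a`-equation there).
[cite: IwaniecActaArith1980, §6 (6.12)] -/
theorem hasDerivAt_pairA_of_lt {s : ℝ} (hs : β < s) (hs' : s < β + 1) :
    HasDerivAt (sieveInnerProduct κ (majA κ β) (adjG κ β))
      (adjG κ β s * (κ * (β - 1) ^ (-κ) * (s - 1) ^ (-κ - 1))) s := by
  have hs0 : 0 < s := by linarith
  refine hasDerivAt_sieveInnerProduct_inhom (a := κ + 1) (d := 0) (by linarith)
    (hasDerivAt_majA_of_lt hβ hs hs') ?_ (hasDerivAt_mul_adjG hβ h0 hs0)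
    (continuousOn_adjG_mul_majA hβ)
  rw [mul_div_cancel₀ _ hs0.ne']

omit hκ in
/-- **`⟨a, G⟩` has derivative `0` on `(β + 1, ∞)`** ((6.12): "there exist constants `c₁` …").
[cite: IwaniecActaArith1980, §6 (6.12)] -/
theorem hasDerivAt_pairA_of_gt {s : ℝ} (hs : β + 1 < s) :
    HasDerivAt (sieveInnerProduct κ (majA κ β) (adjG κ β)) 0 s := by
  have hs0 : 0 < s := by linarith
  have h := hasDerivAt_sieveInnerProduct_inhom (a := κ + 1) (E := 0) (d := 0) (by linarith)
    (hasDerivAt_majA_of_gt hβ hs) ?_ (hasDerivAt_mul_adjG hβ h0 hs0)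
    (continuousOn_adjG_mul_majA hβ)
  · simpa using h
  · rw [mul_div_cancel₀ _ hs0.ne', add_zero]

omit hκ h0 in
/-- **The derivative of `⟨b, 1⟩(s) = s b(s) + κ ∫_{s−1}^s b(x) dx` on `(β, β + 1)`**:
`κ (β − 1)^{−κ} (s − 1)^{−κ−1}` (the adjoint of (6.9) is `H ≡ 1`, (6.11)).
[cite: IwaniecActaArith1980, §6 (6.13)] -/
theorem hasDerivAt_pairB_of_lt {s : ℝ} (hs : β < s) (hs' : s < β + 1) :
    HasDerivAt (sieveInnerProduct (-κ) (majB κ β) (fun _ => 1))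
      (1 * (κ * (β - 1) ^ (-κ) * (s - 1) ^ (-κ - 1))) s := by
  have hs0 : 0 < s := by linarith
  have hr : HasDerivAt (fun t : ℝ => t * 1) ((κ + 1) * 1 + (-κ) * 1) s := by
    simpa using ((hasDerivAt_id s).mul_const (1:ℝ)).congr_deriv (by ring)
  refine hasDerivAt_sieveInnerProduct_inhom (a := κ + 1) (d := 0) (by linarith)
    (hasDerivAt_majB_of_lt hβ hs hs') ?_ hr (continuousOn_const.mul (continuousOn_majB hβ))
  rw [mul_div_cancel₀ _ hs0.ne']

omit hκ h0 in
/-- **`⟨b, 1⟩` has derivative `0` on `(β + 1, ∞)`** ((6.13)). [cite: IwaniecActaArith1980, §6 (6.13)] -/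
theorem hasDerivAt_pairB_of_gt {s : ℝ} (hs : β + 1 < s) :
    HasDerivAt (sieveInnerProduct (-κ) (majB κ β) (fun _ => 1)) 0 s := by
  have hs0 : 0 < s := by linarith
  have hr : HasDerivAt (fun t : ℝ => t * 1) ((κ + 1) * 1 + (-κ) * 1) s := by
    simpa using ((hasDerivAt_id s).mul_const (1:ℝ)).congr_deriv (by ring)
  have h := hasDerivAt_sieveInnerProduct_inhom (a := κ + 1) (E := 0) (d := 0) (by linarith)
    (hasDerivAt_majB_of_gt (κ := κ) hβ hs) ?_ hr (continuousOn_const.mul (continuousOn_majB hβ))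
  · simpa using h
  · rw [mul_div_cancel₀ _ hs0.ne', add_zero]

omit hκ h0 in
/-- `⟨a, G⟩` is continuous on `(1, ∞)`. [folklore] -/
theorem continuousOn_pairA :
    ContinuousOn (sieveInnerProduct κ (majA κ β) (adjG κ β)) (Ioi 1) := by
  have hA := continuousOn_majA (κ := κ) hβ
  have hG := continuousOn_adjG (κ := κ) hβ
  have hprod := continuousOn_adjG_mul_majA (κ := κ) hβ
  have h1 : ContinuousOn (fun s => s * adjG κ β s * majA κ β s) (Ioi 1) :=
    ((continuousOn_id.mul (hG.mono fun s (hs : 1 < s) => show (0:ℝ) < s by linarith)).mul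
      (hA.mono fun s (hs : 1 < s) => show (0:ℝ) < s by linarith))
  have h2 : ContinuousOn (fun u => ∫ x in (u - 1)..u, adjG κ β (x + 1) * majA κ β x) (Ioi 1) :=
    fun u (hu : 1 < u) =>
      (hasDerivAt_integral_sub_one (d := 0) (by linarith) hprod).continuousAt.continuousWithinAt
  exact h1.sub (continuousOn_const.mul h2)

omit hκ h0 in
/-- `⟨b, 1⟩` is continuous on `(1, ∞)`. [folklore] -/
theorem continuousOn_pairB :
    ContinuousOn (sieveInnerProduct (-κ) (majB κ β) (fun _ => 1)) (Ioi 1) := by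
  have hB := continuousOn_majB (κ := κ) hβ
  have hprod : ContinuousOn (fun x => (1:ℝ) * majB κ β x) (Ioi 0) := continuousOn_const.mul hB
  have h1 : ContinuousOn (fun s => s * 1 * majB κ β s) (Ioi 1) :=
    (continuousOn_id.mul continuousOn_const).mul
      (hB.mono fun s (hs : 1 < s) => show (0:ℝ) < s by linarith)
  have h2 : ContinuousOn (fun u => ∫ x in (u - 1)..u, (1:ℝ) * majB κ β x) (Ioi 1) :=
    fun u (hu : 1 < u) =>
      (hasDerivAt_integral_sub_one (d := 0) (by linarith) hprod).continuousAt.continuousWithinAt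
  exact h1.sub (continuousOn_const.mul h2)

omit h0 in
/-- **`⟨b, 1⟩(β) = (β^{−κ} − (β − 1)^{−κ}) (β − 1)^{−κ}`** (from (6.1) on `[β − 1, β]`).
[cite: IwaniecActaArith1980, §6 (6.7), (6.13)] -/
theorem pairB_beta : sieveInnerProduct (-κ) (majB κ β) (fun _ => 1) β =
    (β ^ (-κ) - (β - 1) ^ (-κ)) * (β - 1) ^ (-κ) := by
  have hβ0 : 0 < β := by linarith
  have hI : ∫ x in (β - 1)..β, (1:ℝ) * majB κ β x =
      (β ^ (-κ) - (β - 1) ^ (-κ)) * (((β - 1) ^ (-κ) - β ^ (-κ)) / κ) := by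
    rw [← integral_rpow_neg hκ.ne' hβ, ← intervalIntegral.integral_const_mul]
    refine intervalIntegral.integral_congr fun x hx => ?_
    rw [uIcc_of_le (by linarith)] at hx
    rw [one_mul, majB_eq_of_le hx.2]
  rw [sieveInnerProduct, hI, majB_eq_of_le le_rfl,
    show (-κ - 1 : ℝ) = -κ + (-1) by ring, Real.rpow_add hβ0, Real.rpow_neg_one]
  field_simp
  ring

omit h0 in
/-- **`⟨a, G⟩(β) = (β^{−κ} + (β − 1)^{−κ}) (β − 1)^{−κ} G(β − 1)`** (from (6.1) and (6.17)).
[cite: IwaniecActaArith1980, §6 (6.6), (6.12), (6.17)] -/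
theorem pairA_beta (h0 : qFun κ (β - 1) = 0) : sieveInnerProduct κ (majA κ β) (adjG κ β) β =
    (β ^ (-κ) + (β - 1) ^ (-κ)) * (β - 1) ^ (-κ) * adjG κ β (β - 1) := by
  have hβ0 : 0 < β := by linarith
  set ca : ℝ := β ^ (-κ) + (β - 1) ^ (-κ) with hca
  have hI : ∫ x in (β - 1)..β, adjG κ β (x + 1) * majA κ β x =
      ca * (1 / κ) * (β ^ (-κ) * adjG κ β β - (β - 1) ^ (-κ) * adjG κ β (β - 1)) := by
    rw [← integral_rpow_mul_adjG hβ h0, ← intervalIntegral.integral_const_mul]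
    refine intervalIntegral.integral_congr fun x hx => ?_
    rw [uIcc_of_le (by linarith)] at hx
    rw [majA_eq_of_le hx.2, ← hca]
    field_simp
  rw [sieveInnerProduct, hI, majA_eq_of_le le_rfl, ← hca,
    show (-κ - 1 : ℝ) = -κ + (-1) by ring, Real.rpow_add hβ0, Real.rpow_neg_one]
  field_simp
  ring

omit h0 in
/-- **`c₂ = 0`: `⟨b, 1⟩(β + 1) = 0`** (Iwaniec, p. 190: "substitute `s = β + 1` and utilize (6.6)
and (6.7)"). [cite: IwaniecActaArith1980, §6 (6.13)] -/
theorem pairB_beta_add_one : sieveInnerProduct (-κ) (majB κ β) (fun _ => 1) (β + 1) = 0 := by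
  set I := sieveInnerProduct (-κ) (majB κ β) (fun _ => 1) with hIdef
  have hIc := continuousOn_pairB (κ := κ) hβ
  have hderc : ContinuousOn (fun s : ℝ => 1 * (κ * (β - 1) ^ (-κ) * (s - 1) ^ (-κ - 1)))
      (Icc β (β + 1)) :=
    continuousOn_const.mul (continuousOn_const.mul ((continuousOn_id.sub continuousOn_const).rpow_const
      fun s hs => Or.inl (sub_ne_zero.mpr (by simp only [id]; linarith [hs.1]))))
  have h1 : ∫ s in β..(β + 1), 1 * (κ * (β - 1) ^ (-κ) * (s - 1) ^ (-κ - 1)) = I (β + 1) - I β :=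
    integral_eq_sub_of_hasDerivAt_of_le (by linarith)
      (hIc.mono fun s hs => show (1:ℝ) < s by linarith [hs.1])
      (fun s hs => hasDerivAt_pairB_of_lt hβ hs.1 hs.2)
      (hderc.mono (by rw [uIcc_of_le (by linarith)])).intervalIntegrable
  have h2 : ∫ s in β..(β + 1), 1 * (κ * (β - 1) ^ (-κ) * (s - 1) ^ (-κ - 1)) =
      (β - 1) ^ (-κ) * ((β - 1) ^ (-κ) - β ^ (-κ)) := by
    rw [← integral_rpow_sub_one hκ.ne' hβ, ← intervalIntegral.integral_const_mul]
    refine intervalIntegral.integral_congr fun s _ => ?_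
    ring
  have h3 : I β = (β ^ (-κ) - (β - 1) ^ (-κ)) * (β - 1) ^ (-κ) := pairB_beta hκ hβ
  have : I (β + 1) = I β + (β - 1) ^ (-κ) * ((β - 1) ^ (-κ) - β ^ (-κ)) := by linarith
  rw [this, h3]
  ring

/-- **`c₁ = 0`: `⟨a, G⟩(β + 1) = 0`** (Iwaniec, p. 190). [cite: IwaniecActaArith1980, §6 (6.12)] -/
theorem pairA_beta_add_one : sieveInnerProduct κ (majA κ β) (adjG κ β) (β + 1) = 0 := by
  set I := sieveInnerProduct κ (majA κ β) (adjG κ β) with hIdef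
  have hIc := continuousOn_pairA (κ := κ) hβ
  have hderc : ContinuousOn (fun s : ℝ => adjG κ β s * (κ * (β - 1) ^ (-κ) * (s - 1) ^ (-κ - 1)))
      (Icc β (β + 1)) := by
    refine ((continuousOn_adjG hβ).mono fun s hs => show (0:ℝ) < s by linarith [hs.1]).mul
      (continuousOn_const.mul ((continuousOn_id.sub continuousOn_const).rpow_const fun s hs =>
        Or.inl (sub_ne_zero.mpr (by simp only [id]; linarith [hs.1]))))
  have h1 : ∫ s in β..(β + 1), adjG κ β s * (κ * (β - 1) ^ (-κ) * (s - 1) ^ (-κ - 1)) =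
      I (β + 1) - I β :=
    integral_eq_sub_of_hasDerivAt_of_le (by linarith)
      (hIc.mono fun s hs => show (1:ℝ) < s by linarith [hs.1])
      (fun s hs => hasDerivAt_pairA_of_lt hβ h0 hs.1 hs.2)
      (hderc.mono (by rw [uIcc_of_le (by linarith)])).intervalIntegrable
  have h2 : ∫ s in β..(β + 1), adjG κ β s * (κ * (β - 1) ^ (-κ) * (s - 1) ^ (-κ - 1)) =
      (β - 1) ^ (-κ) * (β ^ (-κ) * adjG κ β β - (β - 1) ^ (-κ) * adjG κ β (β - 1)) := by
    rw [← integral_rpow_mul_adjG' hβ h0, ← intervalIntegral.integral_const_mul]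
    refine intervalIntegral.integral_congr fun s _ => ?_
    ring
  have h3 := pairA_beta hκ hβ h0
  have h4 := adjG_beta_sub_one_eq_neg (κ := κ) (β := β)
  have : I (β + 1) = I β + (β - 1) ^ (-κ) * (β ^ (-κ) * adjG κ β β -
      (β - 1) ^ (-κ) * adjG κ β (β - 1)) := by linarith
  rw [this, hIdef, h3, h4]
  ring

/-- **(6.12) with `c₁ = 0`**: `⟨a, G⟩(R) = 0`, i.e. `R G(R) a(R) = κ ∫_{R−1}^R G(x + 1) a(x) dx`,
for `R ≥ β + 1`. [cite: IwaniecActaArith1980, §6 (6.12)] -/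
theorem pairA_eq_zero {R : ℝ} (hR : β + 1 ≤ R) :
    sieveInnerProduct κ (majA κ β) (adjG κ β) R = 0 := by
  rcases eq_or_lt_of_le hR with h | h
  · rw [← h]; exact pairA_beta_add_one hκ hβ h0
  · rw [eq_of_hasDerivAt_zero_Ioo h ((continuousOn_pairA hβ).mono fun s hs =>
      show (1:ℝ) < s by linarith [hs.1]) fun s hs => hasDerivAt_pairA_of_gt hβ h0 hs.1]
    exact pairA_beta_add_one hκ hβ h0

omit h0 in
/-- **(6.13) with `c₂ = 0`**: `⟨b, 1⟩(R) = 0`, i.e. `R b(R) = −κ ∫_{R−1}^R b(x) dx`, for `R ≥ β + 1`.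
[cite: IwaniecActaArith1980, §6 (6.13)] -/
theorem pairB_eq_zero {R : ℝ} (hR : β + 1 ≤ R) :
    sieveInnerProduct (-κ) (majB κ β) (fun _ => 1) R = 0 := by
  rcases eq_or_lt_of_le hR with h | h
  · rw [← h]; exact pairB_beta_add_one hκ hβ
  · rw [eq_of_hasDerivAt_zero_Ioo h ((continuousOn_pairB hβ).mono fun s hs =>
      show (1:ℝ) < s by linarith [hs.1]) fun s hs => hasDerivAt_pairB_of_gt hβ hs.1]
    exact pairB_beta_add_one hκ hβ

end Pairings

/-! ### Positivity of `q^±` (Lemma 14, in the form `|b| < a`) -/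

section Positivity

variable (hκ : 0 < κ) (hβ : 1 < β) (h0 : qFun κ (β - 1) = 0)
  (hg : ∀ x : ℝ, β - 1 < x → 0 < qFun κ x)
include hκ hβ h0 hg

/-- **The function `Ψ(t) = t^{−κ} (G(t) + G(β))` increases beyond `β`**: `Ψ(t) > Ψ(β) = 2β^{−κ} G(β)`
for `t > β`, since `Ψ'(t) = κ t^{−κ−1} (G(t + 1) − G(β)) > 0` for `t > β − 1` (Iwaniec, p. 191: the
function `C(t) = (β/t)^κ (1 + G(t)/G(β))` "is increasing for `t > β`… Hence `C(t) > C(β) = 2`").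
[cite: IwaniecActaArith1980, §6 (p. 191)] -/
theorem rpow_mul_adjG_add_gt {t : ℝ} (ht : β < t) :
    β ^ (-κ) * (adjG κ β β + adjG κ β β) < t ^ (-κ) * (adjG κ β t + adjG κ β β) := by
  have hβ0 : 0 < β := by linarith
  have hΨ : ∀ u : ℝ, 0 < u → HasDerivAt (fun v : ℝ => v ^ (-κ) * (adjG κ β v + adjG κ β β))
      (κ * u ^ (-κ - 1) * (adjG κ β (u + 1) - adjG κ β β)) u := by
    intro u hu
    have h1 := hasDerivAt_rpow_neg_mul_adjG hβ h0 hu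
    have h2 : HasDerivAt (fun v : ℝ => v ^ (-κ)) (-κ * u ^ (-κ - 1)) u := by
      simpa using (hasDerivAt_id u).rpow_const (p := -κ) (Or.inl hu.ne')
    have h := h1.add (h2.mul_const (adjG κ β β))
    refine (h.congr_of_eventuallyEq (Eventually.of_forall fun v => ?_)).congr_deriv (by ring)
    show v ^ (-κ) * (adjG κ β v + adjG κ β β) = v ^ (-κ) * adjG κ β v + v ^ (-κ) * adjG κ β β
    ring
  have hderc : ContinuousOn (fun u : ℝ => κ * u ^ (-κ - 1) * (adjG κ β (u + 1) - adjG κ β β))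
      (Ioi 0) :=
    (continuousOn_const.mul (continuousOn_id.rpow_const fun t ht => Or.inl (ne_of_gt ht))).mul
      ((continuousOn_comp_add_one (continuousOn_adjG hβ)).sub continuousOn_const)
  have hint : ∫ u in β..t, κ * u ^ (-κ - 1) * (adjG κ β (u + 1) - adjG κ β β) =
      t ^ (-κ) * (adjG κ β t + adjG κ β β) - β ^ (-κ) * (adjG κ β β + adjG κ β β) := by
    refine integral_eq_sub_of_hasDerivAt (fun u hu => hΨ u ?_) ?_
    · rw [uIcc_of_le ht.le] at hu; linarith [hu.1]
    · exact (hderc.mono fun u hu => by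
        rw [uIcc_of_le ht.le] at hu
        exact show (0:ℝ) < u by linarith [hu.1]).intervalIntegrable
  have hpos : 0 < ∫ u in β..t, κ * u ^ (-κ - 1) * (adjG κ β (u + 1) - adjG κ β β) := by
    refine intervalIntegral_pos_of_pos_on ?_ (fun u hu => ?_) ht
    · exact (hderc.mono fun u hu => by
        rw [uIcc_of_le ht.le] at hu
        exact show (0:ℝ) < u by linarith [hu.1]).intervalIntegrable
    · have hu0 : 0 < u := by linarith [hu.1]
      have hG : adjG κ β β < adjG κ β (u + 1) :=
        adjG_lt_adjG hκ hβ hg (by linarith) (by linarith [hu.1])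
      have : 0 < u ^ (-κ - 1) := Real.rpow_pos_of_pos hu0 _
      have : 0 < adjG κ β (u + 1) - adjG κ β β := by linarith
      positivity
  linarith

omit hg in
/-- `∫_β^{β+1} κ (x − 1)^{−κ−1} (G(x) + G(β)) dx = 2 G(β) (β − 1)^{−κ}` ((6.17) plus `G(β)` times (6.18),
with `G(β − 1) = −G(β)`; Iwaniec, p. 191, first display). [cite: IwaniecActaArith1980, §6 (6.17)–(6.18)] -/
theorem integral_kernel_adjG_add :
    ∫ x in β..(β + 1), κ * (x - 1) ^ (-κ - 1) * (adjG κ β x + adjG κ β β) =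
      2 * adjG κ β β * (β - 1) ^ (-κ) := by
  have h17 := integral_rpow_mul_adjG' hβ h0
  have h18 := integral_rpow_sub_one hκ.ne' hβ
  have hneg := adjG_beta_sub_one_eq_neg (κ := κ) (β := β)
  have hc1 : ContinuousOn (fun x : ℝ => κ * (x - 1) ^ (-κ - 1)) (Icc β (β + 1)) :=
    continuousOn_const.mul ((continuousOn_id.sub continuousOn_const).rpow_const fun s hs =>
      Or.inl (sub_ne_zero.mpr (by simp only [id]; linarith [hs.1])))
  have hc2 : ContinuousOn (fun x : ℝ => κ * (x - 1) ^ (-κ - 1) * adjG κ β x) (Icc β (β + 1)) :=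
    hc1.mul ((continuousOn_adjG hβ).mono fun s hs => show (0:ℝ) < s by linarith [hs.1])
  have hi1 : IntervalIntegrable (fun x : ℝ => κ * (x - 1) ^ (-κ - 1)) volume β (β + 1) :=
    (hc1.mono (by rw [uIcc_of_le (by linarith)])).intervalIntegrable
  have hi2 : IntervalIntegrable (fun x : ℝ => κ * (x - 1) ^ (-κ - 1) * adjG κ β x) volume β (β + 1) :=
    (hc2.mono (by rw [uIcc_of_le (by linarith)])).intervalIntegrable
  have hsplit : ∫ x in β..(β + 1), κ * (x - 1) ^ (-κ - 1) * (adjG κ β x + adjG κ β β) =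
      (∫ x in β..(β + 1), κ * (x - 1) ^ (-κ - 1) * adjG κ β x) +
        adjG κ β β * ∫ x in β..(β + 1), κ * (x - 1) ^ (-κ - 1) := by
    rw [← intervalIntegral.integral_const_mul, ← intervalIntegral.integral_add hi2 (hi1.const_mul _)]
    refine intervalIntegral.integral_congr fun x _ => ?_
    ring
  rw [hsplit, h17, h18, hneg]
  ring

/-- **`q⁻(β + 1) > 0`**, i.e. (6.16): `κ ∫_β^{β+1} t^κ (t − 1)^{−κ−1} dt < (β/(β − 1))^κ`
(Iwaniec, p. 190–191, via (6.17)–(6.18) and the monotonicity of `C(t)`).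
[cite: IwaniecActaArith1980, §6 (6.15)–(6.16)] -/
theorem qLower_beta_add_one_pos : 0 < qLower κ β (β + 1) := by
  have hβ0 : 0 < β := by linarith
  have hGβ := adjG_beta_pos hκ hβ hg
  -- `I₂ = q⁻(β) − q⁻(β+1)`
  have hq := qLower_sub_eq_integral (κ := κ) hβ le_rfl (by linarith : β ≤ β + 1)
  rw [qLower_eq le_rfl] at hq
  have hI1 := integral_kernel_adjG_add hκ hβ h0
  -- continuity / integrability of the two integrands on `[β, β+1]`
  have hc1 : ContinuousOn (fun x : ℝ => κ * (x - 1) ^ (-κ - 1)) (Icc β (β + 1)) :=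
    continuousOn_const.mul ((continuousOn_id.sub continuousOn_const).rpow_const fun s hs =>
      Or.inl (sub_ne_zero.mpr (by simp only [id]; linarith [hs.1])))
  have hcA : ContinuousOn (fun x : ℝ => κ * (x - 1) ^ (-κ - 1) * (adjG κ β x + adjG κ β β))
      (Icc β (β + 1)) :=
    hc1.mul (((continuousOn_adjG hβ).mono fun s hs => show (0:ℝ) < s by linarith [hs.1]).add
      continuousOn_const)
  have hcB : ContinuousOn (fun t : ℝ => κ * t ^ κ * (t - 1) ^ (-κ - 1) * qUpper κ β (t - 1))
      (Icc β (β + 1)) := by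
    refine ((continuousOn_const.mul (continuousOn_id.rpow_const fun t ht =>
      Or.inl (ne_of_gt (show (0:ℝ) < t by linarith [ht.1])))).mul
      ((continuousOn_id.sub continuousOn_const).rpow_const fun s hs =>
        Or.inl (sub_ne_zero.mpr (by simp only [id]; linarith [hs.1])))).mul ?_
    exact (continuousOn_qUpper hβ).comp (continuousOn_id.sub continuousOn_const)
      fun t ht => show (0:ℝ) < id t - 1 by simp only [id]; linarith [ht.1]
  have hiA : IntervalIntegrable (fun x : ℝ => κ * (x - 1) ^ (-κ - 1) * (adjG κ β x + adjG κ β β))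
      volume β (β + 1) := (hcA.mono (by rw [uIcc_of_le (by linarith)])).intervalIntegrable
  have hiB : IntervalIntegrable (fun t : ℝ => κ * t ^ κ * (t - 1) ^ (-κ - 1) * qUpper κ β (t - 1))
      volume β (β + 1) := (hcB.mono (by rw [uIcc_of_le (by linarith)])).intervalIntegrable
  -- the difference has positive integral
  have hpos : 0 < ∫ x in β..(β + 1), (κ * (x - 1) ^ (-κ - 1) * (adjG κ β x + adjG κ β β) -
      2 * adjG κ β β * (κ * x ^ κ * (x - 1) ^ (-κ - 1) * qUpper κ β (x - 1))) := by
    refine intervalIntegral_pos_of_pos_on (hiA.sub (hiB.const_mul _)) (fun x hx => ?_)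
      (by linarith)
    have hx0 : 0 < x := by linarith [hx.1]
    have hx1 : 0 < x - 1 := by linarith [hx.1]
    have hΨ := rpow_mul_adjG_add_gt hκ hβ h0 hg hx.1
    rw [qUpper_eq (by linarith [hx.2] : x - 1 ≤ β + 1)]
    have hxk : 0 < x ^ κ := Real.rpow_pos_of_pos hx0 κ
    have hk1 : 0 < (x - 1) ^ (-κ - 1) := Real.rpow_pos_of_pos hx1 _
    have e : x ^ κ * x ^ (-κ) = 1 := by
      rw [← Real.rpow_add hx0, add_neg_cancel, Real.rpow_zero]
    -- `(G x + G β) - 2 G(β) x^κ β^{-κ} = x^κ (Ψ(x) - Ψ(β)) > 0`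
    have key : 0 < (adjG κ β x + adjG κ β β) - 2 * adjG κ β β * (x ^ κ * β ^ (-κ)) := by
      have : (adjG κ β x + adjG κ β β) - 2 * adjG κ β β * (x ^ κ * β ^ (-κ)) =
          x ^ κ * (x ^ (-κ) * (adjG κ β x + adjG κ β β) - β ^ (-κ) * (adjG κ β β + adjG κ β β)) := by
        linear_combination -(adjG κ β x + adjG κ β β) * e
      rw [this]
      exact mul_pos hxk (by linarith)
    have : κ * (x - 1) ^ (-κ - 1) * (adjG κ β x + adjG κ β β) -
        2 * adjG κ β β * (κ * x ^ κ * (x - 1) ^ (-κ - 1) * β ^ (-κ)) =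
        κ * (x - 1) ^ (-κ - 1) * ((adjG κ β x + adjG κ β β) - 2 * adjG κ β β * (x ^ κ * β ^ (-κ))) := by
      ring
    rw [this]
    positivity
  rw [intervalIntegral.integral_sub hiA (hiB.const_mul _), intervalIntegral.integral_const_mul, hI1,
    ← hq] at hpos
  -- `2 G(β) (β-1)^{-κ} - 2 G(β) ((β-1)^{-κ} - q⁻(β+1)) > 0`
  nlinarith

omit hκ h0 hg in
/-- `q⁺ > 0` on `(0, β + 1]` ((6.1): `q⁺ = β^{−κ}` there). [cite: IwaniecActaArith1980, §6 (6.1)] -/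
theorem qUpper_pos_of_le {s : ℝ} (hs : s ≤ β + 1) : 0 < qUpper κ β s := by
  rw [qUpper_eq hs]; exact Real.rpow_pos_of_pos (by linarith) _

/-- `q⁻ > 0` on `(0, β + 1]` (`q⁻` decreases on `[β, β + 1]` to `q⁻(β + 1) > 0`; (6.15)).
[cite: IwaniecActaArith1980, §6 (6.15)] -/
theorem qLower_pos_of_le {s : ℝ} (hs : s ≤ β + 1) : 0 < qLower κ β s := by
  rcases le_or_gt s β with h | h
  · rw [qLower_eq h]; exact Real.rpow_pos_of_pos (by linarith) _
  · have hsub := qLower_sub_eq_integral (κ := κ) hβ h.le hs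
    have hnn : 0 ≤ ∫ t in s..(β + 1), κ * t ^ κ * (t - 1) ^ (-κ - 1) * qUpper κ β (t - 1) := by
      refine intervalIntegral.integral_nonneg hs fun t ht => ?_
      rw [qUpper_eq (by linarith [ht.2] : t - 1 ≤ β + 1)]
      have : 0 < t := by linarith [ht.1]
      have : 0 < t - 1 := by linarith [ht.1]
      positivity
    linarith [qLower_beta_add_one_pos hκ hβ h0 hg]

/-- **Lemma 14 (positivity half): `q⁺ > 0` and `q⁻ > 0` on `(0, ∞)`**, equivalently `|b| < a`
(Iwaniec's Lemma 14 with `η = 1`). Beyond `β + 1` this is the continuation argument of p. 191: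
at the first `u ≥ β + 1` where `|b(u)| ≥ a(u)` one would get, from (6.13), (6.12) (with
`c₁ = c₂ = 0`) and the monotonicity of `G`,
`u |b(u)| ≤ κ ∫_{u−1}^u |b| ≤ κ ∫_{u−1}^u a < κ ∫_{u−1}^u a(x) G(x + 1)/G(u) dx = u a(u)`,
a contradiction. [cite: IwaniecActaArith1980, Lemma 14] -/
theorem qUpper_pos_qLower_pos (s : ℝ) : 0 < qUpper κ β s ∧ 0 < qLower κ β s := by
  by_contra hneg
  have hβ0 : 0 < β := by linarith
  -- the closed set of bad points in `[β + 1, ∞)`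
  set S : Set ℝ := {u | β + 1 ≤ u ∧ qUpper κ β u ⊓ qLower κ β u ≤ 0} with hSdef
  have hmin_of_not : ∀ x, ¬(0 < qUpper κ β x ∧ 0 < qLower κ β x) →
      qUpper κ β x ⊓ qLower κ β x ≤ 0 := fun x hx => by
    rcases not_and_or.mp hx with h | h
    · exact inf_le_of_left_le (not_lt.mp h)
    · exact inf_le_of_right_le (not_lt.mp h)
  have hpos_le : ∀ x, x ≤ β + 1 → 0 < qUpper κ β x ∧ 0 < qLower κ β x := fun x hx =>
    ⟨qUpper_pos_of_le hβ hx, qLower_pos_of_le hκ hβ h0 hg hx⟩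
  have hsS : s ∈ S := by
    refine ⟨?_, hmin_of_not s hneg⟩
    by_contra h
    exact hneg (hpos_le s (not_le.mp h).le)
  have hne : S.Nonempty := ⟨s, hsS⟩
  have hbdd : BddBelow S := ⟨β + 1, fun u hu => hu.1⟩
  have hsub : Ici (β + 1) ⊆ Ioi (0:ℝ) := fun u (hu : β + 1 ≤ u) => show (0:ℝ) < u by linarith
  have hclosed : IsClosed S := by
    have hc : ContinuousOn (fun u => qUpper κ β u ⊓ qLower κ β u) (Ici (β + 1)) :=
      ContinuousOn.inf ((continuousOn_qUpper hβ).mono hsub) ((continuousOn_qLower hβ).mono hsub)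
    exact hc.preimage_isClosed_of_isClosed isClosed_Ici isClosed_Iic
  set u := sInf S with hudef
  have huS : u ∈ S := hclosed.csInf_mem hne hbdd
  have hle_of_mem : ∀ x ∈ S, u ≤ x := fun x hx => csInf_le hbdd hx
  -- positivity strictly below `u`
  have hpos_lt : ∀ x, x < u → 0 < qUpper κ β x ∧ 0 < qLower κ β x := by
    intro x hxu
    by_contra hx
    rcases le_or_gt x (β + 1) with h | h
    · exact hx (hpos_le x h)
    · have := hle_of_mem x ⟨h.le, hmin_of_not x hx⟩
      linarith
  -- `u > β + 1`
  have huβ : β + 1 < u := by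
    rcases eq_or_lt_of_le huS.1 with h | h
    · exfalso
      have h1 := hpos_le u h.symm.le
      have h2 := huS.2
      rw [inf_le_iff] at h2
      rcases h2 with h2 | h2 <;> linarith [h1.1, h1.2]
    · exact h
  have hu0 : 0 < u := by linarith
  -- nonnegativity at `u` (continuity from the left)
  have hev : ∀ᶠ x in 𝓝[<] u, 0 ≤ qUpper κ β x ∧ 0 ≤ qLower κ β x := by
    filter_upwards [Ioo_mem_nhdsLT huβ] with x hx
    exact ⟨(hpos_lt x hx.2).1.le, (hpos_lt x hx.2).2.le⟩
  have hU0 : 0 ≤ qUpper κ β u := by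
    have hc : ContinuousWithinAt (qUpper κ β) (Iio u) u :=
      ((continuousOn_qUpper hβ).continuousAt (Ioi_mem_nhds hu0)).continuousWithinAt
    exact ge_of_tendsto hc.tendsto (hev.mono fun x hx => hx.1)
  have hL0 : 0 ≤ qLower κ β u := by
    have hc : ContinuousWithinAt (qLower κ β) (Iio u) u :=
      ((continuousOn_qLower hβ).continuousAt (Ioi_mem_nhds hu0)).continuousWithinAt
    exact ge_of_tendsto hc.tendsto (hev.mono fun x hx => hx.2)
  -- `|b(u)| ≥ a(u)`
  have hba : majA κ β u ≤ |majB κ β u| := by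
    have hq : qUpper κ β u + qLower κ β u ≤ |qUpper κ β u - qLower κ β u| := by
      have h2 := huS.2
      rw [inf_le_iff] at h2
      rcases h2 with h | h
      · have : qUpper κ β u = 0 := le_antisymm h hU0
        rw [this, zero_sub, abs_neg, abs_of_nonneg hL0, zero_add]
      · have : qLower κ β u = 0 := le_antisymm h hL0
        rw [this, sub_zero, abs_of_nonneg hU0, add_zero]
    have hpow : 0 < u ^ (-κ - 1) := Real.rpow_pos_of_pos hu0 _
    rw [majA, majB, abs_mul, abs_of_pos hpow]
    exact mul_le_mul_of_nonneg_left hq hpow.le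
  -- `|b| ≤ a` below `u`, `a > 0` below `u`, `a(u) ≥ 0`
  have hab : ∀ x, 0 < x → x < u → |majB κ β x| ≤ majA κ β x ∧ 0 < majA κ β x := by
    intro x hx0 hxu
    obtain ⟨hU, hL⟩ := hpos_lt x hxu
    have hpow : 0 < x ^ (-κ - 1) := Real.rpow_pos_of_pos hx0 _
    refine ⟨?_, ?_⟩
    · rw [majA, majB, abs_mul, abs_of_pos hpow]
      refine mul_le_mul_of_nonneg_left (abs_sub_le_iff.mpr ⟨by linarith, by linarith⟩) hpow.le
    · rw [majA]; positivity
  have hau : 0 ≤ majA κ β u := by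
    rw [majA]; exact mul_nonneg (Real.rpow_nonneg hu0.le _) (add_nonneg hU0 hL0)
  -- the pairings at `u`
  have hA := pairA_eq_zero hκ hβ h0 huβ.le
  have hB := pairB_eq_zero hκ hβ huβ.le
  rw [sieveInnerProduct] at hA hB
  -- (i) `u |b(u)| ≤ κ ∫ a`
  have hcontA : ContinuousOn (majA κ β) (Icc (u - 1) u) :=
    (continuousOn_majA hβ).mono fun x hx => show (0:ℝ) < x by linarith [hx.1]
  have hcontB : ContinuousOn (majB κ β) (Icc (u - 1) u) :=
    (continuousOn_majB hβ).mono fun x hx => show (0:ℝ) < x by linarith [hx.1]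
  have hiA : IntervalIntegrable (majA κ β) volume (u - 1) u :=
    (hcontA.mono (by rw [uIcc_of_le (by linarith)])).intervalIntegrable
  have hiB : IntervalIntegrable (majB κ β) volume (u - 1) u :=
    (hcontB.mono (by rw [uIcc_of_le (by linarith)])).intervalIntegrable
  have h1 : u * |majB κ β u| ≤ κ * ∫ x in (u - 1)..u, majA κ β x := by
    have hBeq : u * majB κ β u = -κ * ∫ x in (u - 1)..u, majB κ β x := by
      have : ∫ x in (u - 1)..u, (1:ℝ) * majB κ β x = ∫ x in (u - 1)..u, majB κ β x :=
        intervalIntegral.integral_congr fun x _ => one_mul _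
      rw [this] at hB
      linarith
    have habs : |∫ x in (u - 1)..u, majB κ β x| ≤ ∫ x in (u - 1)..u, |majB κ β x| :=
      intervalIntegral.abs_integral_le_integral_abs (by linarith)
    have hmono : ∫ x in (u - 1)..u, |majB κ β x| ≤ ∫ x in (u - 1)..u, majA κ β x :=
      intervalIntegral.integral_mono_on_of_le_Ioo (by linarith) hiB.abs hiA
        fun x hx => (hab x (by linarith [hx.1]) hx.2).1
    calc u * |majB κ β u| = |u * majB κ β u| := by rw [abs_mul, abs_of_pos hu0]
      _ = κ * |∫ x in (u - 1)..u, majB κ β x| := by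
          rw [hBeq, abs_mul, abs_neg, abs_of_pos hκ]
      _ ≤ κ * ∫ x in (u - 1)..u, majA κ β x :=
          mul_le_mul_of_nonneg_left (habs.trans hmono) hκ.le
  -- (ii) `κ G(u) ∫ a < κ ∫ G(x+1) a(x) dx = u G(u) a(u)`
  have hGu : 0 < adjG κ β u := adjG_pos hκ hβ hg (by linarith)
  have h2 : adjG κ β u * ∫ x in (u - 1)..u, majA κ β x <
      ∫ x in (u - 1)..u, adjG κ β (x + 1) * majA κ β x := by
    rw [← intervalIntegral.integral_const_mul]
    refine intervalIntegral.integral_lt_integral_of_continuousOn_of_le_of_exists_lt (by linarith)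
      (continuousOn_const.mul hcontA)
      (((continuousOn_comp_add_one (continuousOn_adjG hβ)).mono fun x hx =>
        show (0:ℝ) < x by linarith [hx.1]).mul hcontA)
      (fun x hx => ?_) ⟨u - 1 / 2, ⟨by linarith, by linarith⟩, ?_⟩
    · have hax : 0 ≤ majA κ β x := by
        rcases eq_or_lt_of_le hx.2 with h | h
        · rw [h]; exact hau
        · exact (hab x (by linarith [hx.1]) h).2.le
      exact mul_le_mul_of_nonneg_right
        (adjG_le_adjG hκ hβ hg (by linarith) (by linarith [hx.1])) hax
    · have hax : 0 < majA κ β (u - 1 / 2) := (hab _ (by linarith) (by linarith)).2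
      exact mul_lt_mul_of_pos_right
        (adjG_lt_adjG hκ hβ hg (by linarith) (by linarith)) hax
  have h3 : ∫ x in (u - 1)..u, adjG κ β (x + 1) * majA κ β x = u * adjG κ β u * majA κ β u / κ := by
    rw [eq_div_iff hκ.ne']; linarith
  -- combine: `u G(u) |b(u)| ≤ G(u) κ ∫ a < κ ∫ G(x+1) a = u G(u) a(u)`
  have h4 : u * adjG κ β u * |majB κ β u| < u * adjG κ β u * majA κ β u := by
    have := mul_le_mul_of_nonneg_left h1 hGu.le
    have h2' := mul_lt_mul_of_pos_left h2 hκ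
    rw [h3, mul_div_cancel₀ _ hκ.ne'] at h2'
    nlinarith
  have h5 : |majB κ β u| < majA κ β u := lt_of_mul_lt_mul_left h4 (by positivity)
  linarith

end Positivity

/-! ### Decay of `q^±` (from (6.12), without the asymptotics (6.4)–(6.5)) -/

section Decay

variable (hκ : 0 < κ) (hβ : 1 < β) (h0 : qFun κ (β - 1) = 0)
  (hg : ∀ x : ℝ, β - 1 < x → 0 < qFun κ x)
include hκ hβ h0 hg

/-- `a > 0` on `(0, ∞)`. [cite: IwaniecActaArith1980, Lemma 14] -/
theorem majA_pos {s : ℝ} (hs : 0 < s) : 0 < majA κ β s := by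
  obtain ⟨hU, hL⟩ := qUpper_pos_qLower_pos hκ hβ h0 hg s
  rw [majA]
  exact mul_pos (Real.rpow_pos_of_pos hs _) (by linarith)

/-- **`a` is decreasing on `[β + 1, ∞)`** ((6.8): `s a' = −(κ + 1) a − κ a(s − 1) < 0`; Iwaniec,
p. 191, "From (6.8) `a(s)` is [de]creasing"). [cite: IwaniecActaArith1980, §6 (6.8), Lemma 15] -/
theorem majA_antitoneOn : AntitoneOn (majA κ β) (Ici (β + 1)) := by
  have hcont : ContinuousOn (majA κ β) (Ici (β + 1)) :=
    (continuousOn_majA hβ).mono fun s (hs : β + 1 ≤ s) => show (0:ℝ) < s by linarith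
  refine antitoneOn_of_deriv_nonpos (convex_Ici _) hcont ?_ ?_
  · rw [interior_Ici]
    exact fun s hs => (hasDerivAt_majA_of_gt hβ hs).differentiableAt.differentiableWithinAt
  · rw [interior_Ici]
    intro s (hs : β + 1 < s)
    rw [(hasDerivAt_majA_of_gt hβ hs).deriv]
    have h1 := majA_pos hκ hβ h0 hg (by linarith : 0 < s)
    have h2 := majA_pos hκ hβ h0 hg (by linarith : 0 < s - 1)
    have : -(κ + 1) * majA κ β s - κ * majA κ β (s - 1) ≤ 0 := by nlinarith
    exact div_nonpos_of_nonpos_of_nonneg this (by linarith)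

/-- **One step of decay** (from (6.12) with `c₁ = 0`, `a` decreasing and `G` increasing):
`s G(s) a(s) = κ ∫_{s−1}^s G(x + 1) a(x) dx ≤ κ G(s + 1) a(s − 1)` for `s ≥ β + 2`.
[cite: IwaniecActaArith1980, §6 (6.12)] -/
theorem mul_adjG_mul_majA_le {s : ℝ} (hs : β + 2 ≤ s) :
    s * adjG κ β s * majA κ β s ≤ κ * adjG κ β (s + 1) * majA κ β (s - 1) := by
  have hA := pairA_eq_zero hκ hβ h0 (by linarith : β + 1 ≤ s)
  rw [sieveInnerProduct] at hA
  have hcontA : ContinuousOn (majA κ β) (Icc (s - 1) s) :=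
    (continuousOn_majA hβ).mono fun x hx => show (0:ℝ) < x by linarith [hx.1]
  have hcont : ContinuousOn (fun x => adjG κ β (x + 1) * majA κ β x) (Icc (s - 1) s) :=
    ((continuousOn_comp_add_one (continuousOn_adjG hβ)).mono fun x hx =>
      show (0:ℝ) < x by linarith [hx.1]).mul hcontA
  have hmono : ∫ x in (s - 1)..s, adjG κ β (x + 1) * majA κ β x ≤
      ∫ x in (s - 1)..s, adjG κ β (s + 1) * majA κ β (s - 1) := by
    refine intervalIntegral.integral_mono_on (by linarith)
      (hcont.mono (by rw [uIcc_of_le (by linarith)])).intervalIntegrable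
      intervalIntegrable_const (fun x hx => ?_)
    have hG1 : adjG κ β (x + 1) ≤ adjG κ β (s + 1) :=
      adjG_le_adjG hκ hβ hg (by linarith [hx.1]) (by linarith [hx.2])
    have hG0 : 0 ≤ adjG κ β (x + 1) := (adjG_pos hκ hβ hg (by linarith [hx.1])).le
    have ha1 : majA κ β x ≤ majA κ β (s - 1) :=
      majA_antitoneOn hκ hβ h0 hg (show β + 1 ≤ s - 1 by linarith) (show β + 1 ≤ x by linarith [hx.1])
        hx.1
    have ha0 : 0 ≤ majA κ β (s - 1) := (majA_pos hκ hβ h0 hg (by linarith)).le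
    exact mul_le_mul hG1 ha1 ((majA_pos hκ hβ h0 hg (by linarith [hx.1])).le)
      (hG0.trans hG1)
  rw [intervalIntegral.integral_const, show s - (s - 1) = (1:ℝ) by ring, one_smul] at hmono
  have : s * adjG κ β s * majA κ β s = κ * ∫ x in (s - 1)..s, adjG κ β (x + 1) * majA κ β x := by
    linarith
  rw [this, mul_assoc]
  exact mul_le_mul_of_nonneg_left hmono hκ.le

omit h0 in
/-- **Two-sided polynomial control of `g` and a lower bound for `G`**: there is `s₀ ≥ β + 2` such
that for `s ≥ s₀`, `g(s) ≤ 2 s^{2κ−1}` and `G(s) ≥ s^{2κ}/4` (from `s^{1−2κ} g(s) → 1`).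
[cite: Greaves2001, (4.2.3.13)] -/
theorem exists_adjG_ge :
    ∃ s₀ : ℝ, β + 2 ≤ s₀ ∧ ∀ s : ℝ, s₀ ≤ s →
      qFun κ s ≤ 2 * s ^ (2 * κ - 1) ∧ s ^ (2 * κ) / 4 ≤ adjG κ β s := by
  have ht := tendsto_rpow_mul_qFun (le_of_lt hκ)
  have hev : ∀ᶠ s in atTop, 1 / 2 < s ^ (1 - 2 * κ) * qFun κ s ∧ s ^ (1 - 2 * κ) * qFun κ s < 2 :=
    ((tendsto_order.1 ht).1 (1 / 2) (by norm_num)).and ((tendsto_order.1 ht).2 2 (by norm_num))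
  obtain ⟨s₁, hs₁⟩ := eventually_atTop.mp (hev.and (eventually_ge_atTop (β + 2)))
  -- bounds for `g` beyond `s₁`
  have hgb : ∀ s, s₁ ≤ s → s ^ (2 * κ - 1) / 2 ≤ qFun κ s ∧ qFun κ s ≤ 2 * s ^ (2 * κ - 1) := by
    intro s hs
    obtain ⟨⟨h1, h2⟩, hsβ⟩ := hs₁ s hs
    have hs0 : 0 < s := by linarith
    have hpow : 0 < s ^ (2 * κ - 1) := Real.rpow_pos_of_pos hs0 _
    have e : s ^ (2 * κ - 1) * s ^ (1 - 2 * κ) = 1 := by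
      rw [← Real.rpow_add hs0, show (2 * κ - 1 + (1 - 2 * κ) : ℝ) = 0 by ring, Real.rpow_zero]
    have hq : qFun κ s = s ^ (2 * κ - 1) * (s ^ (1 - 2 * κ) * qFun κ s) := by
      rw [← mul_assoc, e, one_mul]
    constructor
    · rw [hq]; nlinarith
    · rw [hq]; nlinarith
  have hs₁β : β + 2 ≤ s₁ := (hs₁ s₁ le_rfl).2
  have hs₁0 : 0 < s₁ := by linarith
  -- choose `s₀` with `s₀^{2κ} ≥ 2 s₁^{2κ}`
  obtain ⟨s₀, hs₀⟩ := eventually_atTop.mp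
    (((tendsto_rpow_atTop (by linarith : 0 < 2 * κ)).eventually_ge_atTop (2 * s₁ ^ (2 * κ))).and
      (eventually_ge_atTop s₁))
  refine ⟨s₀, hs₁β.trans (hs₀ s₀ le_rfl).2, fun s hs => ⟨(hgb s ((hs₀ s hs).2)).2, ?_⟩⟩
  obtain ⟨hpow2, hss₁⟩ := hs₀ s hs
  have hs0 : 0 < s := by linarith
  -- `G(s) = G(s₁) + 2κ ∫_{s₁}^s g ≥ 0 + 2κ ∫_{s₁}^s x^{2κ-1}/2`
  have hG1 : 0 ≤ adjG κ β s₁ := (adjG_pos hκ hβ hg (by linarith)).le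
  have hdiff := adjG_sub_adjG (κ := κ) hβ hs₁0 hs0
  have hc : ContinuousOn (fun x : ℝ => x ^ (2 * κ - 1) / 2) (Icc s₁ s) :=
    (continuousOn_id.rpow_const fun x hx => Or.inl (ne_of_gt (show (0:ℝ) < x by
      linarith [hx.1]))).div_const _
  have hint : ∫ x in s₁..s, x ^ (2 * κ - 1) / 2 ≤ ∫ x in s₁..s, qFun κ x :=
    intervalIntegral.integral_mono_on hss₁
      (hc.mono (by rw [uIcc_of_le hss₁])).intervalIntegrable
      (intervalIntegrable_qFun hs₁0 hs0) fun x hx => (hgb x hx.1).1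
  have hrpow : ∫ x in s₁..s, x ^ (2 * κ - 1) / 2 = (s ^ (2 * κ) - s₁ ^ (2 * κ)) / (4 * κ) := by
    rw [intervalIntegral.integral_div, integral_rpow (Or.inl (by linarith)),
      show (2 * κ - 1 + 1 : ℝ) = 2 * κ by ring]
    field_simp
    ring
  rw [hrpow] at hint
  have h4κ : 0 < 4 * κ := by linarith
  have : 2 * κ * ((s ^ (2 * κ) - s₁ ^ (2 * κ)) / (4 * κ)) = (s ^ (2 * κ) - s₁ ^ (2 * κ)) / 2 := by
    field_simp; ring
  nlinarith [mul_le_mul_of_nonneg_left hint (by linarith : (0:ℝ) ≤ 2 * κ)]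

/-- **The ratio bound**: there is `s₀ ≥ β + 2` with `a(s) ≤ (16κ/s) a(s − 1)` for `s ≥ s₀`
(`G(s + 1) ≤ 2 s g(s) ≤ 4 s^{2κ}` and `G(s) ≥ s^{2κ}/4`). [cite: IwaniecActaArith1980, §6 (6.12)] -/
theorem exists_majA_le_div :
    ∃ s₀ : ℝ, β + 2 ≤ s₀ ∧ ∀ s : ℝ, s₀ ≤ s → majA κ β s ≤ 16 * κ / s * majA κ β (s - 1) := by
  obtain ⟨s₀, hs₀β, hs₀⟩ := exists_adjG_ge hκ hβ hg
  refine ⟨s₀, hs₀β, fun s hs => ?_⟩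
  obtain ⟨hgs, hGs⟩ := hs₀ s hs
  have hs0 : 0 < s := by linarith
  have hstep := mul_adjG_mul_majA_le hκ hβ h0 hg (hs₀β.trans hs)
  have hG1 : adjG κ β (s + 1) ≤ 2 * s * qFun κ s := adjG_add_one_le hκ hβ hg h0 (by linarith)
  have hpow : 0 < s ^ (2 * κ) := Real.rpow_pos_of_pos hs0 _
  have hGpos : 0 < adjG κ β s := by linarith
  have ha1 : 0 ≤ majA κ β (s - 1) := (majA_pos hκ hβ h0 hg (by linarith)).le
  have e : s * s ^ (2 * κ - 1) = s ^ (2 * κ) := by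
    rw [← Real.rpow_one_add' hs0.le (by linarith), show (1 + (2 * κ - 1) : ℝ) = 2 * κ by ring]
  -- `s G(s) a(s) ≤ κ G(s+1) a(s-1) ≤ κ · 4 s^{2κ} · a(s-1)` and `G(s) ≥ s^{2κ}/4`
  have h1 : s * adjG κ β s * majA κ β s ≤ κ * (4 * s ^ (2 * κ)) * majA κ β (s - 1) := by
    refine hstep.trans ?_
    have : adjG κ β (s + 1) ≤ 4 * s ^ (2 * κ) := by nlinarith
    exact mul_le_mul_of_nonneg_right (mul_le_mul_of_nonneg_left this hκ.le) ha1
  rw [div_mul_eq_mul_div, le_div_iff₀ hs0]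
  -- `a(s) s ≤ 16 κ a(s-1)`: multiply by `G(s) ≥ s^{2κ}/4 > 0`
  have h2 : s * majA κ β s * (s ^ (2 * κ) / 4) ≤ s * majA κ β s * adjG κ β s :=
    mul_le_mul_of_nonneg_left hGs (mul_nonneg hs0.le (majA_pos hκ hβ h0 hg hs0).le)
  nlinarith

/-- **Super-exponential decay of `a`**: for every `M ≥ 0` there are `K` and `s₂` with
`e^{Ms} a(s) ≤ K` for `s ≥ s₂ − 1` (iterate `a(s) ≤ (16κ/s) a(s − 1)` from `s₂ = max(s₀, 16κ e^M)`).
[cite: IwaniecActaArith1980, §6 (6.5)] -/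
theorem exists_exp_mul_majA_le {M : ℝ} (hM : 0 ≤ M) :
    ∃ K s₂ : ℝ, β + 2 ≤ s₂ ∧ ∀ s : ℝ, s₂ - 1 ≤ s → Real.exp (M * s) * majA κ β s ≤ K := by
  obtain ⟨s₀, hs₀β, hs₀⟩ := exists_majA_le_div hκ hβ h0 hg
  set s₂ : ℝ := max s₀ (16 * κ * Real.exp M) with hs₂
  have hs₂0 : s₀ ≤ s₂ := le_max_left _ _
  have hs₂β : β + 2 ≤ s₂ := hs₀β.trans hs₂0
  set K : ℝ := Real.exp (M * s₂) * majA κ β (s₂ - 1) with hK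
  -- one step: `h(s) ≤ h(s-1)` for `s ≥ s₂`
  have hstep : ∀ s, s₂ ≤ s →
      Real.exp (M * s) * majA κ β s ≤ Real.exp (M * (s - 1)) * majA κ β (s - 1) := by
    intro s hs
    have hs0 : 0 < s := by linarith
    have h1 := hs₀ s (hs₂0.trans hs)
    have ha1 : 0 ≤ majA κ β (s - 1) := (majA_pos hκ hβ h0 hg (by linarith)).le
    have hratio : Real.exp M * (16 * κ / s) ≤ 1 := by
      rw [← mul_div_assoc, div_le_one hs0]
      have : 16 * κ * Real.exp M ≤ s := (le_max_right _ _).trans hs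
      linarith
    have he : Real.exp (M * s) = Real.exp (M * (s - 1)) * Real.exp M := by
      rw [← Real.exp_add]; ring_nf
    calc Real.exp (M * s) * majA κ β s
        ≤ Real.exp (M * s) * (16 * κ / s * majA κ β (s - 1)) :=
          mul_le_mul_of_nonneg_left h1 (Real.exp_pos _).le
      _ = Real.exp (M * (s - 1)) * majA κ β (s - 1) * (Real.exp M * (16 * κ / s)) := by
          rw [he]; ring
      _ ≤ Real.exp (M * (s - 1)) * majA κ β (s - 1) * 1 :=
          mul_le_mul_of_nonneg_left hratio (mul_nonneg (Real.exp_pos _).le ha1)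
      _ = _ := mul_one _
  -- base: `h ≤ K` on `[s₂ - 1, s₂)`
  have hbase : ∀ s, s₂ - 1 ≤ s → s < s₂ → Real.exp (M * s) * majA κ β s ≤ K := by
    intro s hs hs'
    have ha : majA κ β s ≤ majA κ β (s₂ - 1) :=
      majA_antitoneOn hκ hβ h0 hg (show β + 1 ≤ s₂ - 1 by linarith) (show β + 1 ≤ s by linarith) hs
    have he : Real.exp (M * s) ≤ Real.exp (M * s₂) := Real.exp_le_exp.mpr (by nlinarith)
    exact mul_le_mul he ha (majA_pos hκ hβ h0 hg (by linarith)).le (Real.exp_pos _).le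
  -- induction on the number of steps
  have hind : ∀ n : ℕ, ∀ s, s₂ - 1 ≤ s → s < s₂ + n → Real.exp (M * s) * majA κ β s ≤ K := by
    intro n
    induction n with
    | zero => intro s hs hs'; exact hbase s hs (by simpa using hs')
    | succ n ih =>
      intro s hs hs'
      rcases lt_or_ge s s₂ with h | h
      · exact hbase s hs h
      · exact (hstep s h).trans (ih (s - 1) (by linarith) (by push_cast at hs'; linarith))
  refine ⟨K, s₂, hs₂β, fun s hs => ?_⟩
  obtain ⟨n, hn⟩ := exists_nat_gt (s - s₂)
  exact hind n s hs (by linarith)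

/-- **Super-exponential decay of `q⁺ + q⁻ = s^{κ+1} a(s)`**: for every `M`, eventually
`q⁺(s) + q⁻(s) ≤ e^{−Ms}`. [cite: IwaniecActaArith1980, Lemma 13 (6.3), (6.5)] -/
theorem eventually_qUpper_add_qLower_le (M : ℝ) :
    ∀ᶠ s in atTop, qUpper κ β s + qLower κ β s ≤ Real.exp (-(M * s)) := by
  obtain ⟨K, s₂, hs₂β, hK⟩ := exists_exp_mul_majA_le hκ hβ h0 hg (M := |M| + 1) (by positivity)
  have hK0 : 0 ≤ K := by
    have := hK s₂ (by linarith)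
    exact le_trans (mul_nonneg (Real.exp_pos _).le (majA_pos hκ hβ h0 hg (by linarith)).le) this
  -- `K s^{κ+1} e^{-s} ≤ 1` eventually
  have ht := (tendsto_rpow_mul_exp_neg_mul_atTop_nhds_zero (κ + 1) 1 one_pos).const_mul K
  rw [mul_zero] at ht
  filter_upwards [ht.eventually_lt_const one_pos, eventually_ge_atTop s₂] with s hs hss₂
  have hs0 : 0 < s := by linarith
  have hpow : 0 < s ^ (κ + 1) := Real.rpow_pos_of_pos hs0 _
  have hmaj := hK s (by linarith)
  -- `q⁺ + q⁻ = s^{κ+1} a(s)`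
  have hsum : qUpper κ β s + qLower κ β s = s ^ (κ + 1) * majA κ β s := by
    rw [majA, ← mul_assoc, ← Real.rpow_add hs0, show (κ + 1 + (-κ - 1) : ℝ) = 0 by ring,
      Real.rpow_zero, one_mul]
  rw [hsum]
  have ha0 : 0 ≤ majA κ β s := (majA_pos hκ hβ h0 hg hs0).le
  -- `s^{κ+1} a(s) ≤ s^{κ+1} K e^{-(|M|+1) s} = (K s^{κ+1} e^{-s}) e^{-|M| s} ≤ e^{-|M| s} ≤ e^{-M s}`
  have h1 : majA κ β s ≤ K * Real.exp (-((|M| + 1) * s)) := by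
    rw [Real.exp_neg, ← div_eq_mul_inv, le_div_iff₀ (Real.exp_pos _), mul_comm]
    exact hmaj
  have h2 : Real.exp (-(|M| * s)) ≤ Real.exp (-(M * s)) :=
    Real.exp_le_exp.mpr (by nlinarith [le_abs_self M, hs0.le])
  calc s ^ (κ + 1) * majA κ β s ≤ s ^ (κ + 1) * (K * Real.exp (-((|M| + 1) * s))) :=
        mul_le_mul_of_nonneg_left h1 hpow.le
    _ = K * (s ^ (κ + 1) * Real.exp (-1 * s)) * Real.exp (-(|M| * s)) := by
        rw [show (-((|M| + 1) * s) : ℝ) = -1 * s + -(|M| * s) by ring, Real.exp_add]; ring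
    _ ≤ 1 * Real.exp (-(|M| * s)) := mul_le_mul_of_nonneg_right hs.le (Real.exp_pos _).le
    _ ≤ Real.exp (-(M * s)) := by rw [one_mul]; exact h2

end Decay

end RosserMajorant

/-! ### Assembly: the majorant hypotheses, Lemmas 17–18 and Theorem 1 without Lemma 13 -/

namespace BetaSieve

variable {κ : ℝ} {B : (ℝ → ℝ) × (ℝ → ℝ) × ℝ × ℝ}

/-- **The majorant hypotheses hold for the greatest `β`-sieve data of dimension `κ > 1/2`**
(`β > 1`, `q^± > 0` on `(0, ∞)`, super-exponential decay of `q^±`) — the part of Iwaniec's Lemma 13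
used for Lemmas 17–18, now proved. [cite: IwaniecActaArith1980, Lemma 13 and Lemma 14] -/
theorem majorantHyp_of_greatest (hκ : 1 / 2 < κ) (hB : IsGreatestBetaSieveData κ B) :
    MajorantHyp κ B.2.2.1 := by
  have hβ := hB.one_lt_beta hκ
  have h0 := hB.qFun_beta_sub_one hκ
  have hg : ∀ x, B.2.2.1 - 1 < x → 0 < qFun κ x := fun x hx => hB.qFun_pos_of_gt hκ hx
  have hκ0 : 0 < κ := by linarith
  have hpos := RosserMajorant.qUpper_pos_qLower_pos hκ0 hβ h0 hg
  refine ⟨hβ, fun s _ => hpos s, fun M => ?_, fun M => ?_⟩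
  · filter_upwards [RosserMajorant.eventually_qUpper_add_qLower_le hκ0 hβ h0 hg M] with s hs
    linarith [(hpos s).2]
  · filter_upwards [RosserMajorant.eventually_qUpper_add_qLower_le hκ0 hβ h0 hg M] with s hs
    linarith [(hpos s).1]

/-- **Lemma 17 for the greatest data of dimension `κ > 1/2`, unconditionally** (the positivity
input of `exists_const_contT_lt_of_pos` is now proved). [cite: IwaniecActaArith1980, Lemma 17] -/
theorem lemma17 (hκ : 1 / 2 < κ) (hB : IsGreatestBetaSieveData κ B) :
    ∃ c : ℝ, 0 < c ∧ ∀ N : ℕ,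
      (∀ s : ℝ, B.2.2.1 ≤ s → contT 0 κ B.2.2.1 N s < c * qLower κ B.2.2.1 s) ∧
      (∀ s : ℝ, B.2.2.1 - 1 ≤ s → contT 1 κ B.2.2.1 N s < c * qUpper κ B.2.2.1 s) :=
  exists_const_contT_lt_of_pos (by linarith) (majorantHyp_of_greatest hκ hB).one_lt
    (majorantHyp_of_greatest hκ hB).pos

/-- **Lemma 18 for the greatest data of dimension `κ > 1/2`, unconditionally**: for every `N`, `s`,
`T⁺_N(s) ≤ s^κ (F(s) − 1)` (`s ≥ β + 1`) and `T⁻_N(s) ≤ s^κ (1 − f(s))` (`s ≥ β`).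
[cite: IwaniecActaArith1980, Lemma 18] -/
theorem lemma18 (hκ : 1 / 2 < κ) (hB : IsGreatestBetaSieveData κ B) (N : ℕ) (s : ℝ) :
    (B.2.2.1 + 1 ≤ s → contT 1 κ B.2.2.1 N s ≤ s ^ κ * (B.1 s - 1)) ∧
      (B.2.2.1 ≤ s → contT 0 κ B.2.2.1 N s ≤ s ^ κ * (1 - B.2.1 s)) :=
  lemma18_of_majorantHyp hκ hB (majorantHyp_of_greatest hκ hB) N s

/-- **`F = 1 + s^{−κ} T⁺`, `f = 1 − s^{−κ} T⁻` (`s > β`), `A = (β + 1)^κ + T⁺(β + 1)` for the greatest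
data of dimension `κ > 1/2`, unconditionally** (Iwaniec, p. 202). [cite: IwaniecActaArith1980, §9 (p. 202)] -/
theorem eqOn_cand_of_greatest (hκ : 1 / 2 < κ) (hB : IsGreatestBetaSieveData κ B) :
    B.2.2.2 = candConst κ B.2.2.1 ∧ EqOn B.1 (candUpper κ B.2.2.1) (Ioi 0) ∧
      EqOn B.2.1 (candLower κ B.2.2.1) (Ioi 0) :=
  eqOn_cand hκ hB (majorantHyp_of_greatest hκ hB)

/-- **`Iwaniec1980_lemma18` from its boundary case `κ = 1/2` alone.**
[cite: IwaniecActaArith1980, Lemma 18] -/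
theorem Iwaniec1980_lemma18_of_half (hhalf : Iwaniec1980_lemma18_half) : Iwaniec1980_lemma18 := by
  intro κ hκ B hB N s
  rcases eq_or_lt_of_le hκ with h | h
  · subst h
    exact hhalf B hB N s
  · exact lemma18 h hB N s

/-- **Iwaniec's main-term lower bound from Lemma 20 (and Lemma 18 at `κ = 1/2`).**
[cite: IwaniecActaArith1980, Thm 1 with (1.6)] -/
theorem Iwaniec1980_mainTerm_lower_of_lemma20 (hhalf : Iwaniec1980_lemma18_half)
    (h20 : Iwaniec1980_lemma20) : Iwaniec1980_mainTerm_lower :=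
  Iwaniec1980_mainTerm_lower_of exists_isGreatestBetaSieveData_holds
    (Iwaniec1980_lemma18_of_half hhalf) h20

/-- **Iwaniec's main-term upper bound from Lemma 20 (and Lemma 18 at `κ = 1/2`).**
[cite: IwaniecActaArith1980, Thm 1 with (1.7)] -/
theorem Iwaniec1980_mainTerm_upper_of_lemma20 (hhalf : Iwaniec1980_lemma18_half)
    (h20 : Iwaniec1980_lemma20) : Iwaniec1980_mainTerm_upper :=
  Iwaniec1980_mainTerm_upper_of exists_isGreatestBetaSieveData_holds
    (Iwaniec1980_lemma18_of_half hhalf) h20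

end BetaSieve

/-- **Iwaniec's Theorem 1, lower bound, for a sieve sequence — from Lemma 20 (and Lemma 18 at
`κ = 1/2`)**: the corrected form `SieveSequence.Iwaniec1980_lower` of the misstated
`SieveSequence.jurkat_richert_lower`. [cite: IwaniecActaArith1980, Thm 1 with (1.6)] -/
theorem SieveSequence.Iwaniec1980_lower_of_lemma20 (hhalf : BetaSieve.Iwaniec1980_lemma18_half)
    (h20 : Iwaniec1980_lemma20) : SieveSequence.Iwaniec1980_lower :=
  SieveSequence.Iwaniec1980_lower_of_mainTerm
    (BetaSieve.Iwaniec1980_mainTerm_lower_of_lemma20 hhalf h20)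

/-- **Iwaniec's Theorem 1, upper bound, for a sieve sequence — from Lemma 20 (and Lemma 18 at
`κ = 1/2`).** [cite: IwaniecActaArith1980, Thm 1 with (1.7)] -/
theorem SieveSequence.Iwaniec1980_upper_of_lemma20 (hhalf : BetaSieve.Iwaniec1980_lemma18_half)
    (h20 : Iwaniec1980_lemma20) : SieveSequence.Iwaniec1980_upper :=
  SieveSequence.Iwaniec1980_upper_of_mainTerm
    (BetaSieve.Iwaniec1980_mainTerm_upper_of_lemma20 hhalf h20)

end Literature.NumberTheory.Sieve
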